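import Mathlib
import Literature.MathematicalPhysics.QuantumFieldTheory.Balaban1983to89.T4SliceTelescoping

/-!
# T⁴ programme, node NE3 (η-rate of the minimisers) — the FLUX FORM of the two-grid defect:
# the consistency input (W2) bypassed at the price of one logarithm

Seventh-generation leaf of the NE3 prover lineage P1 (technique: implicit-function / fixed-point structure of the
one-step constrained variational problem, Bałaban CMP 102 (1985) 277–309 = "B11", Sect. E, read since generation 5 as
the DISCRETE implicit-function theorem = STABILITY × CONSISTENCY).  A NEW LEAF: it imports `T4SliceTelescoping` (v1.1:
`sandwich_pointwise`, `profile_of_slices`, `core_of_slices`, `sliceConst`, and through it `T4TwoSpacingDefect` §7 = the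
wall `ConsistencySized`) and touches nothing in it.

## The point (MODEL mathematics: exact algebra and finite sums; the dictionary is stated, never asserted)

Generation 5 cut the (115)-currency wall into STABILITY — clause (T2), the double-layer constant of `∇G_k`,
discharged from per-scale OPERATOR data of printed type by generation 6 — and CONSISTENCY — clauses (T3)/(T4): the
two-grid TRUNCATION ERROR `τ = K·U_{k+1}(V)`, `K := Q₁Δ_f − Δ_cQ₁`, read as a NEUTRAL DIPOLE LAYER on the unit-face
skeleton with face density `≤ C_J·λ̂` and everything else `≤ C_B(1 + k log L)·λ̂` (λ̂ = sup of the one-step multiplier).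
That reading is the TRANSMISSION STRUCTURE of the fine minimiser across unit faces, (W2) — unprinted for Bałaban's
objects (B11 (45)–(46) print two differences of the linear minimiser, nothing finer), and its single logarithm encodes a
face-INTERIOR cancellation (the dipole density is smooth along a face away from its edges).  The observation of this
leaf: NO SUCH STRUCTURE IS NEEDED for the rate class.  Three steps, all kernel-checked below over abstract rings /
fields / finite sums:
 (1) FLUX FORM (exact algebra, every lattice function, no smoothness).  In one dimension the two-grid defect of L-block
     means FACTORS THROUGH THIRD DIFFERENCES and is a coarse DIVERGENCE: `K_L = ∂⁺_c ∘ Ψ_L ∘ ∂³_f` with a stencil `Ψ_L`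
     of `2L − 3` fine sites and total weight `‖Ψ_L‖₁ = L(L² − 1)/12`; on symbols (`z` = fine shift, `S_L = 1 + z + ⋯ +
     z^{L−1}`):  `S_L(z)·[L²z^{L−1}(z − 1)² − (z^L − 1)²] = (z^L − 1)(z − 1)³·R_L(z)`,  `R_L = (L²z^{L−1} − S_L²)/(z − 1)²`,
     `R₂ = −1`, `R₃ = −(z² + 4z + 1)`; closed form `−R_L(z) = Σ_{m=0}^{2L−4} C(min(m, 2L−4−m) + 3, 3)·z^m` (palindromic,
     all coefficients of `R_L` are `≤ 0`, `|R_L(1)| = L²(L² − 1)/12`).  Kernel-checked: the OPERATOR identity at `L = 2`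
     for every `f : ℤ → 𝕜` (`defect₂_eq_cdiff_flux₂`: `(Kf)(j) = g(j+1) − g(j)`, `g(j) = −½(∂³f)(2j − 2)`) and (v1.1) at
     `L = 3` (`defect₃_eq_cdiff_flux₃`, stencil `−⅓·{1, 4, 1}`), the symbol identities at `L = 2, 3` (`symbol_flux_two`,
     `symbol_flux_three`), (v1.1, §2b) the FACTORISATION FOR EVERY `L` — `(z − 1)² ∣ L²z^{L−1} − S_L²` from the double
     zero at `z = 1` (`sq_dvd_blockSymbol`), hence `S_L·[…] = (z^L − 1)(z − 1)³·R_L` for SOME polynomial `R_L`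
     (`defectSymbol_factor`: existence; the closed form of `R_L` is [script]) — the kink example `f = |i|` (flux supported
     on ONE block, defect = a dipole, no bulk term) and the quartic (`defect = −24 ≠ 0`: a genuine second-order error);
     [script `t4/b2b-balaban-t4-ne3-p1/g7/flux_sanity.py`, exact rationals] the operator identity for `L = 2,…,5` and
     the two-direction flux form in `d = 2`; [script `…/g7/rl_closed_form.py`, exact integers] the closed form of `R_L`,
     its palindromy and `|R_L(1)|/L = L(L² − 1)/12` for `L = 2,…,16`.  In `d` directions block means are products of commuting one-dimensional
     means and the Laplacians are sums, so `K = Σ_μ ∂⁺_{c,μ} ∘ (q_⊥μ ⊗ Ψ_μ) ∘ ∂³_{f,μ}` (`defect_product_two`,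
     `defect_fluxForm_two`; ANY number of directions, in particular `d = 4`, over a duplicate-free `List` of directions
     with ordered products: `defect_product_list`, `defect_fluxForm_list`, v1.1 §1b).  CONSEQUENCE (`green_mul_fluxForm`,
     `green_mul_fluxForm_list`):
     `G_cτ = Σ_μ (G_c∂⁺_{c,μ})·flux_μ`,  `flux_μ := (q_⊥μ ⊗ Ψ_μ)(∂³_{f,μ}U_{k+1})` — the propagated truncation error is a
     sum of GRADIENT-of-Green kernels against LOCAL functionals of THIRD DIFFERENCES of the fine minimiser: no face
     decomposition, no dipoles, no transmission conditions.
 (2) THIRD DIFFERENCES FROM THE DIFFERENTIATED EQUATION.  The fine minimiser solves `Δ_fU_{k+1} = Q₁*λ =: h`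
     (B9 (3.123) SHAPE `G⁻¹A = Q*ω`; tower `Q_{k+1}* = Q₁*Q_k*`, `λ = Q_k*ω̃`; the averaging mass does not change the
     minimiser: `T4TwoSpacingDefect.hardMinimiser_indep_of_avgMass`), with `h` CONSTANT on unit cubes.  Differences
     commute with `Δ_f` [flat model; covariant: reading (β) below], so `∂³_μU_{k+1} = (∇_μG_f∇_μ*)(∂_μh)` and `∂_μh` is a
     SINGLE LAYER on the faces `F_μ` normal to `μ` of density `≤ 2λ̂` [covariant: reading (γ)].  A `|z − w|^{−d}` profile
     of the second-difference kernel `∇G_f∇*` — from per-scale operator data with ONE difference on EACH outer factor,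
     exponent `p = d` (`slice_const_le₂`, `slice_bound_of_operatorData₂`, `faceKernel_of_slices` on top of
     `T4SliceTelescoping`; B9 (3.42) items 2 AND 3 are the printed TYPE) — summed over the codimension-one skeleton seen
     from distance `t` (`faceColumn_sum_le`: shells `≤ A·r^{d−2}`, tail `Σ_{r ≥ t} r^{−2} ≤ 2/t`, core `e₀`) gives
     `|∂³_μU_{k+1}(z)| ≤ 2λ̂(e₀ + 2AC′)/max(1, dist(z, F_μ))` (`thirdDiff_le`), hence the FLUX PROFILE
     `|flux_μ(y)| ≤ Φ/max(1, t_μ(y))`, `Φ = C_Φ·λ̂` (`flux_le_of_stencil`, `inv_max_le_of_le_add`).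
 (3) STRATIFIED SUM.  The level sets of `t_μ` are double layers parallel to `F_μ`; the rows of `∇_μG_c` on each are
     bounded by the double-layer constant `DL` of generation 6 (clause (T2): `≤ C_DL(1 + k log L)`), and
     `Σ_{t ≤ L^k} 1/max(1,t) ≤ 2 + k log L` (`sum_inv_max_le`), so `|G_cτ(x)| ≤ DL·Φ·(2 + k log L)`
     (`stratified_abs_sum_le`, `fluxF1_of_kernels`) — ONE MORE LOGARITHM than the typed (T3)/(T4), absorbed into EVERY
     rate `L^{−a}`, `a < 1`, by `(1 + k log L)²L^{−k} ≤ c₂(a)(L^{−a})^k`, `c₂(a) = (2e^{−(1+a)/2}/(1 − a))²`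
     (`one_add_mul_log_sq_mul_pow_le_rpow`, `logSqConst`; `c₂(1/2) = 16e^{−3/2} ≈ 3.57`).  The re-cut wall `FluxSized`
     (F1)–(F5) ⟹ `OneStepCorrectionRate` ⟹ `LocalRate` ⟹ `T4EtaRateMin.NE3Shape` BY NAME (`flux_clause1`,
     `oneStepCorrectionRate_of_flux_rpow`, `oneStepCorrectionRate_of_fluxSized_rpow`, `localRate_of_fluxSized_rpow`,
     `ne3Shape_of_fluxSized_rpow`).
NET EFFECT on the list of unprinted inputs of the node (record `t4/T4-EST-U1b-OSC.md` §5): (W2) — a statement about the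
INTERIOR STRUCTURE of the fine minimiser — LEAVES the list for the rate class `{L^{−a} : a < 1}`; the single logarithm of
(T3)/(T4) is exactly what (W2) proper would add, and the flat truth is log-free ([toy] below).  What replaces it is of
the same kind as generation 6's replacement of (W1): (W2′) per-scale operator data of printed TYPE for ONE MORE
telescoped kernel, `∇G⁽ʲ⁾·(K_j − K_{j+1})·G⁽ʲ⁺¹⁾∇*` (weighted rows of `∇G⁽ʲ⁾` ∝ `L^j` = B9 (3.42) item 2, weighted
columns of `G⁽ʲ⁺¹⁾∇*` ∝ `L^{j+1}` = item 3, block projection ∝ `(L^j)^{−(d+2)}` = (3.49) / [model]), and — for Bałaban's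
covariant, gauge-fixed one-step objects on a class-(3.35) background — three commutation READINGS replacing the three
exact flat identities used in (1)–(2), each with a remainder carrying the small factor `Mα₀` of (3.35) and LINEAR in λ
(they are the `blk` of clause (F4), sized as hypotheses like everything else):
 (α) LOCAL NEUTRALITY OF THE COVARIANT DEFECT: `K_W := Q_W𝔻_f − 𝔻_cQ_W` (`𝔻` = covariant Laplacian + the gauge-fixing
     term `DRD*` of B9 (3.122)) is a covariant coarse divergence of a local functional of third covariant differences,
     up to `O(|F|)·(local, ≤ 2 differences)`;
 (β) `[∇_U, 𝔻] = O(|F|)·∇_U` (the differentiated minimiser equation holds up to a curvature source);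
 (γ) `∇_U(Q_W*λ)` = a face layer of density `≤ 2λ̂` plus an `O(|F|)` bulk term.
NOTHING is asserted about Bałaban's objects: every statement below is over abstract rings / fields / finite sums, the
hypotheses are SHAPES, `FluxSized` is a predicate REACHED from kernel data (`fluxF1_of_kernels`) and CONSUMED only
towards the node's shape, never used as a fact; (α)(β)(γ) and (W2′) are dictionary.

v1.1 (ADDITIVE; every v1 declaration byte-identical to v1 = p188782, sha256[:16] 61b24c6e83fcce6c; only the module
docstring and two section titles edited): §1b the flux form in ANY number of directions (`defect_product_list`,
`defect_fluxForm_list`, `green_mul_fluxForm_list` over a duplicate-free `List` of directions — the v1 remark "more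
directions by iterating" is now kernel, `d = 4` as an `example`); §2 the operator identity at `L = 3`
(`defect₃_eq_cdiff_flux₃`, stencil `Ψ₃ = −⅓·{1, 4, 1}`); §2b the factorisation for EVERY `L` (`sq_dvd_blockSymbol`,
`defectSymbol_factor`: the symbol `L²z^{L−1} − S_L²` has a double zero at `z = 1`).
v1.2 (DOCFIX, docstring-only; every declaration byte-identical to v1.1 = p189079, sha256[:16] a25fea1602da8327): XREAD
C-ref5-169 (b2b-balaban-ref5-g41, journal l.54104; boundary clean, 0 violations) item D2 — guillemets reserved for
quotations: the two non-quotation labels formerly in «» (the word "divergence" in the Samarskii gloss, the pairing label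
"act = Σ_x loc, card X ≤ vol" in §6) now carry plain quotes.

## What is printed and located ([R] = quoted «verbatim» from the materialised text of the held paper; the B9 spans
## are those re-read on the journal-page renders by XREAD C-t4lit2g6-1 for `T4SliceTelescoping` v1.1)

* [R] B9 = Bałaban, *Propagators for lattice gauge theories in a background field*, CMP 99 (1985) 389–434
  (`paper:balaban1985-cmp99-background-propagators`), p. 397: «Theorem 3.1. There exist positive constants M₁, δ₀, a₀,
  B₀ dependent on d and L only, a constant B₀(β) dependent on d, L and β, 0 ≤ β < 1 (B₀(β) → ∞ if β → 1), such that
  for M ≥ M₁ and for an arbitrary configuration U satisfying the regularity condition (3.35) with Mα₀ ≤ a₀, the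
  operator G′(U) (a = 1) satisfies the inequalities» (3.42)–(3.47); (3.42) bounds
  the FOUR items `|(G′(U)λ)(x)|, |(∇_UG′(U)λ)(x)|, |(G′(U)∇*_Uλ)(x)|, |(Δ_UG′(U)λ)(x)|` by `B₀[(L^jη)², L^jη, L^jη, 1]
  e^{−δ₀d(y,y′)}|λ|` for `x ∈ Δ(y)`, `y ∈ Λ_j`, `supp λ ⊂ Δ(y′)` — items 2 AND 3 are the printed TYPE of the row /
  column data of (W2′); p. 399: «the constants in the formulations of both theorems do not depend on the sequence
  {Ω_j}, j = 0, 1,…,k, if the conditions (2.1), (2.2) are satisfied.» and Theorem 3.3 (the same for G(U), «λ replaced by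
  a function J defined at bonds»); (3.49) (the `DPD*` item carries `(L^jη)^{−(d+2)}`); p. 396 (3.35): «|A| <
  O(1)Mα₀(L^jη)^{−1}, |∇^ηA| < O(1)Mα₀(L^jη)^{−2} on □» — the small factor of the remainders (α)(β)(γ).
* [R] B9 p. 420, (3.122)–(3.126): «δh/δA = G⁻¹A − Q*ω = 0, δh/δω = QA − B = 0», «G⁻¹ = Δ_π + DRD* + Q*aQ»,
  «HB = GQ*(QGQ*)⁻¹B. (3.126)» — the SHAPE `𝔻U = Q*ω` of the minimiser equation differentiated in (2).
* [R] B11 p. 285, (45)–(46): the linear minimiser `H` with «LʲηQ_jHB = B on Λ_j, RD*HB = 0, (45) and the Theorem 3.12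
  from [5] implies |HB| ≤ B₀(Lʲη)^{−1}|B|, |∇HB| ≤ B₀(Lʲη)^{−2}|B| on Ω_j. (46)» — print stops at ONE difference of the
  minimiser in sup norm (two with the Hölder bounds): no third-difference or transmission statement is printed, which
  is why this leaf produces third differences from the EQUATION and Green kernels, not from regularity.
* PRECEDENT, not used (the move, in numerical analysis): Tikhonov–Samarskii's treatment of difference schemes with
  DISCONTINUOUS coefficients writes the truncation error in flux ("divergence", negative-norm) form to recover
  second-order accuracy — [corpus: `paper:doi-10-2478-cmam-2009-0002` (Works of A.A. Samarskii, CMAM 2009) p. 4]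
  «Homogeneous difference schemes converge for problems with discontinuous coefficients. To prove this, it is necessary
  to modify the concept of accuracy and derive the error estimates using special negative norms.» (its refs [b2], [b3] =
  Tikhonov–Samarskii 1959, 1961).  The identity (1) is the two-grid (Galerkin-defect) analogue for block means; no
  statement of that literature is imported.
* [toy; `t4/b2b-balaban-t4-ne3-p1/g7/flux_toy.py`, pure python, exact symbols + FFT, 1 core, < 10 core-minutes; flat
  scalar block means, d = 2, L = ℓ = 2, data δ − mean, k = 1…6, 70 s] (i) the flux identity `τ = Σ_μ ∂⁺_μflux_μ` holds to
  rounding (relative residual ≤ 1.3·10⁻¹² up to k = 6) on the actual minimisers; (ii) the flux PROFILE constant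
  `Φ_k := sup_y |flux_μ(y)|·max(1, t_μ(y))/λ̂` = .197 .197 .192 .191 .191 .192 (k = 1…6) — FLAT, attained AT the faces;
  far field (`t ≥ s/4`) `t·|flux|/λ̂ = .010` flat from k = 2 on: the `1/dist` law of (2); (iii) `sup|G_cτ|/λ̂` = .140
  .125 .123 .123 .124 .124 (TRUE; generation 5's flat κ-sized value), the SIGNLESS sum `sup_x Σ|g||flux|/λ̂` = .155
  .168 .180 .190 .199 .208 (discarding all signs costs a factor ≤ 1.67 at k = 6, increments shrinking), the double-layer
  constant of the NORMAL derivative `DL = 1.000` for every k (harmonic-measure sums: in flux form the kernel paired with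
  `flux_μ` is the derivative NORMAL to `F_μ`, whose plane sums carry no logarithm in the flat model), and the lemma's
  stratified bound `P = Σ_μ DL·Φ_μ·(2 + log T)` = .79 .79 1.19 1.51 1.80 2.09 — one logarithm above the truth, by
  design (ratio `P/true` = 5.6 … 16.8).  So in the flat model clause (F1) holds with the typed logarithm NOT attained,
  (F2) holds without its logarithm, and (F3) holds with `C_Φ ≈ 0.20`.

Honest framing: finite-T⁴ ultraviolet bookkeeping about MINIMISERS (rung (B)+1 of the cell's ladder); no conditional
(`BetaPertH`, (B), (B^μ)) enters; nothing here bears on infinite volume, a mass gap, or the Clay problem.  No `sorry`,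
no axioms beyond Mathlib's; ring / field identities and finite-sum estimates are [folklore]; every [model] / reading /
[toy] sentence is dictionary or evidence, never a hypothesis discharged by citation.  Records: `t4/T4-EST-U1b-OSC.md`
v1.10–1.11 (RESULTS 15–16), `t4/T4-EST-NE3-P1.md` v2.8–2.9, GAPS G-ne3p1-22 ff. of the cell `pub-balaban`.
-/

noncomputable section

open Finset Real

namespace Literature.MathematicalPhysics.QuantumFieldTheory.Balaban1983to89.T4DefectFluxForm

open Literature.MathematicalPhysics.QuantumFieldTheory.Balaban1983to89.T4EtaRateMin
  (Readings NE3Shape LocalRate actionRate_of_localRate)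
open Literature.MathematicalPhysics.QuantumFieldTheory.Balaban1983to89.T4FixedPointResponse
  (OneStepCorrectionRate localRate_of_oneStep')
open Literature.MathematicalPhysics.QuantumFieldTheory.Balaban1983to89.T4OneStepFactorisation
  (one_add_le_exp_mul inv_pow_le_rpow_pow rpowRate_lt_one)

/-! ## §1  The flux form (ring identities) -/
section FluxAlgebra

variable {R : Type*} [Ring R]

/-- **Flux form ⇒ propagated form.**  If the two-grid defect is a coarse divergence of local fluxes,
`K = Σ_μ D_μ·F_μ`, then the propagated truncation error is `G·K·U = Σ_μ (G·D_μ)·(F_μ·U)`: gradient-of-Green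
kernels applied to the fluxes of `U`.  [model] Dictionary: `G = G_c` (coarse Green operator), `D_μ = ∂⁺_{c,μ}`,
`F_μ = (q_⊥μ ⊗ Ψ_μ)·∂³_{f,μ}`, `U = U_{k+1}(V)`; `G·K·U = G_cτ = Z′`. [folklore] -/
theorem green_mul_fluxForm {ι : Type*} (s : Finset ι) (G K U : R) (D F : ι → R)
    (hK : K = ∑ μ ∈ s, D μ * F μ) : G * K * U = ∑ μ ∈ s, (G * D μ) * (F μ * U) := by
  rw [hK, Finset.mul_sum, Finset.sum_mul]
  refine Finset.sum_congr rfl fun μ _ => ?_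
  simp only [mul_assoc]

/-- **Product structure of the defect, two directions.**  Block means are products of commuting one-dimensional
means `Q = q₁q₂`, the Laplacians are sums `Δ_f = a₁ + a₂`, `Δ_c = b₁ + b₂`, and the mean in one direction commutes
with the coarse second difference in the other (`b₁q₂ = q₂b₁`, `b₂q₁ = q₁b₂`).  Then
`QΔ_f − Δ_cQ = q₂·(q₁a₁ − b₁q₁) + q₁·(q₂a₂ − b₂q₂)`: the d-dimensional defect is a sum over directions of
(transverse mean) × (one-dimensional defect). [folklore] -/
theorem defect_product_two {q₁ q₂ a₁ a₂ b₁ b₂ : R} (hq : q₁ * q₂ = q₂ * q₁) (hb₁ : b₁ * q₂ = q₂ * b₁)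
    (hb₂ : b₂ * q₁ = q₁ * b₂) :
    (q₁ * q₂) * (a₁ + a₂) - (b₁ + b₂) * (q₁ * q₂)
      = q₂ * (q₁ * a₁ - b₁ * q₁) + q₁ * (q₂ * a₂ - b₂ * q₂) := by
  have e0 : q₁ * q₂ * a₁ = q₂ * (q₁ * a₁) := by rw [hq, mul_assoc]
  have e1 : b₁ * (q₁ * q₂) = q₂ * (b₁ * q₁) := by rw [hq, ← mul_assoc, hb₁, mul_assoc]
  have e2 : b₂ * (q₁ * q₂) = q₁ * (b₂ * q₂) := by rw [← mul_assoc, hb₂, mul_assoc]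
  calc (q₁ * q₂) * (a₁ + a₂) - (b₁ + b₂) * (q₁ * q₂)
      = q₁ * q₂ * a₁ + q₁ * (q₂ * a₂) - b₁ * (q₁ * q₂) - b₂ * (q₁ * q₂) := by noncomm_ring
    _ = q₂ * (q₁ * a₁) + q₁ * (q₂ * a₂) - q₂ * (b₁ * q₁) - q₁ * (b₂ * q₂) := by rw [e0, e1, e2]
    _ = q₂ * (q₁ * a₁ - b₁ * q₁) + q₁ * (q₂ * a₂ - b₂ * q₂) := by noncomm_ring

/-- **One-dimensional flux form ⇒ d-dimensional flux form (two directions).**  If each one-dimensional defect is a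
coarse difference of a flux, `q_μa_μ − b_μq_μ = D_μ·Φ_μ`, and the transverse mean commutes with that difference
(`q₂D₁ = D₁q₂`, `q₁D₂ = D₂q₁`), then `QΔ_f − Δ_cQ = D₁·(q₂Φ₁) + D₂·(q₁Φ₂)`. [folklore] -/
theorem defect_fluxForm_two {q₁ q₂ a₁ a₂ b₁ b₂ D₁ D₂ Φ₁ Φ₂ : R} (hq : q₁ * q₂ = q₂ * q₁)
    (hb₁ : b₁ * q₂ = q₂ * b₁) (hb₂ : b₂ * q₁ = q₁ * b₂) (h₁ : q₁ * a₁ - b₁ * q₁ = D₁ * Φ₁)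
    (h₂ : q₂ * a₂ - b₂ * q₂ = D₂ * Φ₂) (hD₁ : q₂ * D₁ = D₁ * q₂) (hD₂ : q₁ * D₂ = D₂ * q₁) :
    (q₁ * q₂) * (a₁ + a₂) - (b₁ + b₂) * (q₁ * q₂) = D₁ * (q₂ * Φ₁) + D₂ * (q₁ * Φ₂) := by
  rw [defect_product_two hq hb₁ hb₂, h₁, h₂, ← mul_assoc, hD₁, mul_assoc, ← mul_assoc q₁, hD₂, mul_assoc]

end FluxAlgebra

/-! ## §1b  The flux form in any number of directions (v1.1; `List`-indexed products in a ring) -/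
section FluxAlgebraList

variable {R : Type*} [Ring R] {ι : Type*}

/-- An element commuting with each listed mean commutes with their ordered product. [folklore] -/
theorem mul_prod_map_comm_of_mem (q : ι → R) (x : R) :
    ∀ s : List ι, (∀ ν ∈ s, x * q ν = q ν * x) → x * (s.map q).prod = (s.map q).prod * x
  | [], _ => by simp
  | (ν :: s), h => by
      have hν : x * q ν = q ν * x := h ν (List.mem_cons.mpr (Or.inl rfl))
      have hs : ∀ ν' ∈ s, x * q ν' = q ν' * x := fun ν' hν' => h ν' (List.mem_cons.mpr (Or.inr hν'))
      rw [List.map_cons, List.prod_cons, ← mul_assoc, hν, mul_assoc, mul_prod_map_comm_of_mem q x s hs,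
        ← mul_assoc]

/-- An element commuting with each listed summand commutes with their sum. [folklore] -/
theorem sum_map_mul_comm (b : ι → R) (x : R) :
    ∀ s : List ι, (∀ ν ∈ s, b ν * x = x * b ν) → (s.map b).sum * x = x * (s.map b).sum
  | [], _ => by simp
  | (ν :: s), h => by
      have hν : b ν * x = x * b ν := h ν (List.mem_cons.mpr (Or.inl rfl))
      have hs : ∀ ν' ∈ s, b ν' * x = x * b ν' := fun ν' hν' => h ν' (List.mem_cons.mpr (Or.inr hν'))
      rw [List.map_cons, List.sum_cons, add_mul, mul_add, hν, sum_map_mul_comm b x s hs]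

/-- **Product structure of the defect, any number of directions** (the case of interest is `d = 4`).  For a
duplicate-free list `l` of directions, pairwise commuting one-dimensional block means `q_μ`, one-dimensional fine
Laplacians `a_μ` (no hypothesis on them) and coarse ones `b_μ` commuting with the TRANSVERSE means (`b_μq_ν = q_νb_μ`,
`μ ≠ ν`):  `(∏_l q)·(Σ_l a) − (Σ_l b)·(∏_l q) = Σ_{μ ∈ l} (∏_{l ∖ μ} q)·(q_μa_μ − b_μq_μ)` — the d-dimensional two-grid
defect is a sum over directions of (transverse mean) × (one-dimensional defect).  Products are ORDERED `List`
products in a possibly non-commutative ring; `defect_product_two` is the case `l = [1, 2]`. [folklore] -/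
theorem defect_product_list [DecidableEq ι] (q a b : ι → R)
    (hq : ∀ μ ν, q μ * q ν = q ν * q μ) (hb : ∀ μ ν, μ ≠ ν → b μ * q ν = q ν * b μ) :
    ∀ l : List ι, l.Nodup →
      (l.map q).prod * (l.map a).sum - (l.map b).sum * (l.map q).prod
        = (l.map fun μ => ((l.erase μ).map q).prod * (q μ * a μ - b μ * q μ)).sum
  | [], _ => by simp
  | (μ :: t), hnd => by
      obtain ⟨hμt, ht⟩ := List.nodup_cons.mp hnd
      have ih := defect_product_list q a b hq hb t ht
      have h1 : q μ * (t.map q).prod = (t.map q).prod * q μ :=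
        mul_prod_map_comm_of_mem q (q μ) t (fun ν _ => hq μ ν)
      have h2 : b μ * (t.map q).prod = (t.map q).prod * b μ :=
        mul_prod_map_comm_of_mem q (b μ) t (fun ν hν => hb μ ν (fun h => hμt (by simpa [← h] using hν)))
      have h3 : (t.map b).sum * q μ = q μ * (t.map b).sum :=
        sum_map_mul_comm b (q μ) t (fun ν hν => hb ν μ (fun h => hμt (by simpa [h] using hν)))
      have lhs : (((μ :: t).map q).prod * ((μ :: t).map a).sum - ((μ :: t).map b).sum * ((μ :: t).map q).prod)
          = (t.map q).prod * (q μ * a μ - b μ * q μ)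
            + q μ * ((t.map q).prod * (t.map a).sum - (t.map b).sum * (t.map q).prod) := by
        simp only [List.map_cons, List.prod_cons, List.sum_cons]
        have e1 : q μ * (t.map q).prod * a μ = (t.map q).prod * (q μ * a μ) := by rw [h1, mul_assoc]
        have e2 : b μ * (q μ * (t.map q).prod) = (t.map q).prod * (b μ * q μ) := by
          rw [h1, ← mul_assoc, h2, mul_assoc]
        have e3 : (t.map b).sum * (q μ * (t.map q).prod) = q μ * ((t.map b).sum * (t.map q).prod) := by
          rw [← mul_assoc, h3, mul_assoc]
        rw [mul_add, add_mul, e1, e2, e3, mul_assoc (q μ) ((t.map q).prod) ((t.map a).sum), mul_sub, mul_sub]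
        abel
      rw [lhs, ih, List.map_cons, List.sum_cons, List.erase_cons_head]
      congr 1
      rw [← List.sum_map_mul_left]
      congr 1
      apply List.map_congr_left
      intro ν hν
      have hne : ν ≠ μ := fun h => hμt (by simpa [h] using hν)
      rw [List.erase_cons_tail (by simpa using hne.symm), List.map_cons, List.prod_cons, mul_assoc]

/-- **One-dimensional flux forms ⇒ the d-dimensional flux form, any number of directions.**  If each
one-dimensional defect is a coarse divergence, `q_μa_μ − b_μq_μ = D_μ·Φ_μ`, and `D_μ` commutes with the transverse
means, then `(∏ q)·(Σ a) − (Σ b)·(∏ q) = Σ_{μ ∈ l} D_μ·((∏_{l ∖ μ} q)·Φ_μ)`:  `K = Σ_μ ∂⁺_{c,μ}∘(q_⊥μ ⊗ Ψ_μ)∘∂³_{f,μ}`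
in the dictionary of the module docstring — the hypothesis `hK` of `green_mul_fluxForm_list`. [folklore] -/
theorem defect_fluxForm_list [DecidableEq ι] (q a b D Φ : ι → R)
    (hq : ∀ μ ν, q μ * q ν = q ν * q μ) (hb : ∀ μ ν, μ ≠ ν → b μ * q ν = q ν * b μ)
    (hD : ∀ μ ν, μ ≠ ν → D μ * q ν = q ν * D μ) (h : ∀ μ, q μ * a μ - b μ * q μ = D μ * Φ μ)
    (l : List ι) (hl : l.Nodup) :
    (l.map q).prod * (l.map a).sum - (l.map b).sum * (l.map q).prod
      = (l.map fun μ => D μ * (((l.erase μ).map q).prod * Φ μ)).sum := by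
  rw [defect_product_list q a b hq hb l hl]
  congr 1
  apply List.map_congr_left
  intro μ _
  rw [h μ, ← mul_assoc, ← mul_assoc]
  congr 1
  refine (mul_prod_map_comm_of_mem q (D μ) (l.erase μ) (fun ν hν => hD μ ν ?_)).symm
  exact fun hμν => ((List.Nodup.mem_erase_iff hl).mp hν).1 hμν.symm

/-- **Flux form ⇒ propagated form**, list-indexed version of `green_mul_fluxForm`:
`G·K·U = Σ_{μ ∈ l} (G·D_μ)·(F_μ·U)`. [folklore] -/
theorem green_mul_fluxForm_list (G K U : R) (D F : ι → R) (l : List ι)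
    (hK : K = (l.map fun μ => D μ * F μ).sum) :
    G * K * U = (l.map fun μ => (G * D μ) * (F μ * U)).sum := by
  subst hK
  induction l with
  | nil => simp
  | cons μ t ih =>
      simp only [List.map_cons, List.sum_cons, mul_add, add_mul] at ih ⊢
      rw [ih]; congr 1; simp only [mul_assoc]

/-- The case of interest, `d = 4`: four pairwise commuting block means (`List.finRange 4`). -/
example (q a b D Φ : Fin 4 → R)
    (hq : ∀ μ ν, q μ * q ν = q ν * q μ) (hb : ∀ μ ν, μ ≠ ν → b μ * q ν = q ν * b μ)
    (hD : ∀ μ ν, μ ≠ ν → D μ * q ν = q ν * D μ) (h : ∀ μ, q μ * a μ - b μ * q μ = D μ * Φ μ) :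
    ((List.finRange 4).map q).prod * ((List.finRange 4).map a).sum
        - ((List.finRange 4).map b).sum * ((List.finRange 4).map q).prod
      = ((List.finRange 4).map fun μ => D μ * ((((List.finRange 4).erase μ).map q).prod * Φ μ)).sum :=
  defect_fluxForm_list q a b D Φ hq hb hD h _ (List.nodup_finRange 4)

end FluxAlgebraList

/-! ## §2  The one-dimensional stencil identities at `L = 2` (and `L = 3`, v1.1) and the symbol identities at `L = 2, 3` -/
section Stencil

variable {𝕜 : Type*} [Field 𝕜]

/-- Block mean of pairs (`L = 2`): `(Q₁f)(j) = (f(2j) + f(2j+1))/2`. [folklore] -/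
def blockAvg₂ (f : ℤ → 𝕜) (j : ℤ) : 𝕜 := (f (2 * j) + f (2 * j + 1)) / 2

/-- Fine second difference in COARSE units (`L² = 4`): `(Δ_f f)(i) = 4·(f(i+1) − 2f(i) + f(i−1))`. [folklore] -/
def fineLap₂ (f : ℤ → 𝕜) (i : ℤ) : 𝕜 := 4 * (f (i + 1) - 2 * f i + f (i - 1))

/-- Coarse second difference: `(Δ_c g)(j) = g(j+1) − 2g(j) + g(j−1)`. [folklore] -/
def coarseLap (g : ℤ → 𝕜) (j : ℤ) : 𝕜 := g (j + 1) - 2 * g j + g (j - 1)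

/-- The one-dimensional two-grid defect at `L = 2`: `K f = Q₁(Δ_f f) − Δ_c(Q₁ f)`. [folklore] -/
def defect₂ (f : ℤ → 𝕜) (j : ℤ) : 𝕜 := blockAvg₂ (fineLap₂ f) j - coarseLap (blockAvg₂ f) j

/-- Forward third difference: `(∂³f)(i) = f(i+3) − 3f(i+2) + 3f(i+1) − f(i)`. [folklore] -/
def thirdDiff (f : ℤ → 𝕜) (i : ℤ) : 𝕜 := f (i + 3) - 3 * f (i + 2) + 3 * f (i + 1) - f i

/-- The flux at `L = 2`: `g(j) = −½·(∂³f)(2j − 2)` (the fine third difference sampled at the left neighbour block,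
weight `Ψ₂ = {−½}`: symbol `ψ₂(z) = R₂(z)/(2z²)`, `R₂ = −1`). [folklore] -/
def flux₂ (f : ℤ → 𝕜) (j : ℤ) : 𝕜 := -(thirdDiff f (2 * j - 2)) / 2

/-- **THE STENCIL IDENTITY (`L = 2`, one dimension): the two-grid defect is the coarse forward difference of the
flux**, `(Kf)(j) = g(j+1) − g(j)`, `g(j) = −½(∂³f)(2j−2)`, for EVERY `f : ℤ → 𝕜` — exact algebra, no smoothness.
(Symbol: `k(z)·2z² = (z² − 1)(z − 1)³·R₂(z)`, `R₂ = −1`, `symbol_flux_two`.)  [model] Read with `f = U_{k+1}(V)`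
restricted to a lattice line: the truncation error is a DIVERGENCE of a local functional of THIRD differences. [folklore] -/
theorem defect₂_eq_cdiff_flux₂ (f : ℤ → 𝕜) (j : ℤ) : defect₂ f j = flux₂ f (j + 1) - flux₂ f j := by
  simp only [defect₂, blockAvg₂, fineLap₂, coarseLap, flux₂, thirdDiff]
  ring_nf

/-- The flux kills quadratics: for `f(i) = αi² + βi + γ` the flux vanishes identically (third differences of a
quadratic are zero) — so on a stretch where `f` is exactly quadratic (one dimension: between two faces, where
`Δ_f U = const`) the defect has NO bulk term at all. [folklore] -/
theorem flux₂_quadratic (α β γ : 𝕜) (j : ℤ) :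
    flux₂ (fun i : ℤ => α * (i : 𝕜) ^ 2 + β * i + γ) j = 0 := by
  simp only [flux₂, thirdDiff]
  push_cast
  ring

/-- Symbol identity at `L = 2` (commutative variable `z` = fine shift): `S₂(z)·[L²z^{L−1}(z−1)² − (z^L−1)²]
= (z^L − 1)(z − 1)³·R₂(z)` with `S₂ = 1 + z`, `R₂ = −1`. [folklore] -/
theorem symbol_flux_two {S : Type*} [CommRing S] (z : S) :
    (1 + z) * (4 * z * (z - 1) ^ 2 - (z ^ 2 - 1) ^ 2) = (z ^ 2 - 1) * (z - 1) ^ 3 * (-1) := by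
  ring

/-- Symbol identity at `L = 3`: `S₃(z)·[9z²(z−1)² − (z³−1)²] = (z³ − 1)(z − 1)³·R₃(z)`, `R₃ = −(z² + 4z + 1)`
(all coefficients of `R_L` are `≤ 0`; total flux weight `|R_L(1)|/L = L(L²−1)/12`: `½` at `L = 2`, `2` at `L = 3`). [folklore] -/
theorem symbol_flux_three {S : Type*} [CommRing S] (z : S) :
    (1 + z + z ^ 2) * (9 * z ^ 2 * (z - 1) ^ 2 - (z ^ 3 - 1) ^ 2)
      = (z ^ 3 - 1) * (z - 1) ^ 3 * (-(z ^ 2 + 4 * z + 1)) := by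
  ring

/-- Block mean of triples (`L = 3`): `(Q₁f)(j) = (f(3j) + f(3j+1) + f(3j+2))/3`. (v1.1) [folklore] -/
def blockAvg₃ (f : ℤ → 𝕜) (j : ℤ) : 𝕜 := (f (3 * j) + f (3 * j + 1) + f (3 * j + 2)) / 3

/-- Fine second difference in COARSE units at `L = 3` (`L² = 9`). (v1.1) [folklore] -/
def fineLap₃ (f : ℤ → 𝕜) (i : ℤ) : 𝕜 := 9 * (f (i + 1) - 2 * f i + f (i - 1))

/-- The one-dimensional two-grid defect at `L = 3`: `K f = Q₁(Δ_f f) − Δ_c(Q₁ f)`. (v1.1) [folklore] -/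
def defect₃ (f : ℤ → 𝕜) (j : ℤ) : 𝕜 := blockAvg₃ (fineLap₃ f) j - coarseLap (blockAvg₃ f) j

/-- The flux at `L = 3`: `g(j) = −⅓·[(∂³f)(3j−1) + 4(∂³f)(3j−2) + (∂³f)(3j−3)]` — weights `Ψ₃ = −⅓·{1, 4, 1}` read off
`R₃(z) = −(z² + 4z + 1)` (`symbol_flux_three`); total weight `6/3 = 2 = 3·(3² − 1)/12`. (v1.1) [folklore] -/
def flux₃ (f : ℤ → 𝕜) (j : ℤ) : 𝕜 :=
  -(thirdDiff f (3 * j - 1) + 4 * thirdDiff f (3 * j - 2) + thirdDiff f (3 * j - 3)) / 3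

/-- **THE STENCIL IDENTITY at `L = 3`**: `(Kf)(j) = g(j+1) − g(j)` for EVERY `f : ℤ → 𝕜`, with the three-point
third-difference stencil `flux₃` — the `L = 3` instance of `K_L = ∂⁺_c∘Ψ_L∘∂³_f` (exact algebra). (v1.1) [folklore] -/
theorem defect₃_eq_cdiff_flux₃ (f : ℤ → 𝕜) (j : ℤ) : defect₃ f j = flux₃ f (j + 1) - flux₃ f j := by
  simp only [defect₃, blockAvg₃, fineLap₃, coarseLap, flux₃, thirdDiff]
  ring_nf

/-- The flux weights: `|R₂(1)|/2 = 1/2 = 2·(2²−1)/12` and `|R₃(1)|/3 = 6/3 = 3·(3²−1)/12`. -/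
example : ((1 : ℚ)) / 2 = 2 * (2 ^ 2 - 1) / 12 ∧ ((1 + 4 + 1 : ℚ)) / 3 = 3 * (3 ^ 2 - 1) / 12 := by norm_num

end Stencil

/-! ## §2b  The factorisation `K_L = ∂⁺_c∘Ψ_L∘∂³_f` for EVERY block size `L` (v1.1): the double zero of the symbol -/
section SymbolGeneralL

open Polynomial

variable {S : Type*} [CommRing S]

/-- A polynomial with a root at `a` whose derivative also vanishes at `a` is divisible by `(X − a)²` (any commutative
ring; no non-vanishing hypothesis). [folklore] -/
theorem sq_dvd_of_isRoot_of_isRoot_derivative {p : S[X]} {a : S}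
    (h0 : p.IsRoot a) (h1 : (derivative p).IsRoot a) : (X - C a) ^ 2 ∣ p := by
  obtain ⟨q, hq⟩ := dvd_iff_isRoot.mpr h0
  have hq1 : q.IsRoot a := by
    have hd : derivative p = q + (X - C a) * derivative q := by
      rw [hq, derivative_mul, derivative_X_sub_C, one_mul]
    have := h1
    rw [IsRoot, hd, eval_add, eval_mul, eval_sub, eval_X, eval_C, sub_self, zero_mul, add_zero] at this
    exact this
  obtain ⟨r, hr⟩ := dvd_iff_isRoot.mpr hq1
  exact ⟨r, by rw [hq, hr, pow_two, mul_assoc]⟩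

/-- The symbol of the `L`-block sum, `S_L(z) = 1 + z + ⋯ + z^{L−1}` (`z` = the fine shift; `Q_L = L⁻¹·S_L`,
`z^L − 1 = (z − 1)·S_L`). [folklore] -/
noncomputable def blockSymbol (L : ℕ) : S[X] := ∑ i ∈ Finset.range L, X ^ i

/-- `S_L(1) = L`. [folklore] -/
theorem blockSymbol_eval_one (L : ℕ) : (blockSymbol L : S[X]).eval 1 = L := by
  simp [blockSymbol, eval_finsetSum]

/-- `2·S_L′(1) = L(L − 1)`. [folklore] -/
theorem derivative_blockSymbol_eval_one (L : ℕ) :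
    (derivative (blockSymbol L : S[X])).eval 1 * 2 = (L : S) * ((L - 1 : ℕ) : S) := by
  simp only [blockSymbol, derivative_sum, derivative_X_pow, eval_finsetSum, eval_mul, eval_C, eval_pow, eval_X,
    one_pow, mul_one]
  rw [← Nat.cast_sum, ← Nat.cast_ofNat, ← Nat.cast_mul, Finset.sum_range_id_mul_two, Nat.cast_mul]

/-- **`(z − 1)² ∣ L²z^{L−1} − S_L(z)²` for every `L`**: both `p(1) = L² − L² = 0` and `p′(1) = L²(L−1) − 2L·L(L−1)/2 = 0`.
This is the whole content of "the defect factors through THIRD differences": see `defectSymbol_factor`. [folklore] -/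
theorem sq_dvd_blockSymbol (L : ℕ) :
    (X - C (1 : S)) ^ 2 ∣ C ((L : S) ^ 2) * X ^ (L - 1) - (blockSymbol L) ^ 2 := by
  apply sq_dvd_of_isRoot_of_isRoot_derivative
  · simp [IsRoot, blockSymbol_eval_one]
  · have h2 := derivative_blockSymbol_eval_one (S := S) L
    simp only [IsRoot, derivative_sub, derivative_mul, derivative_C, zero_mul, zero_add, derivative_X_pow, pow_two,
      eval_sub, eval_add, eval_mul, eval_C, eval_pow, eval_X, one_pow, mul_one, blockSymbol_eval_one]
    linear_combination (-(L : S)) * h2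

/-- **The one-dimensional defect symbol factors through `(z^L − 1)(z − 1)³` for EVERY `L`**:
`S_L(z)·[L²z^{L−1}(z − 1)² − (z^L − 1)²] = (z^L − 1)(z − 1)³·R_L(z)` for some polynomial `R_L` — i.e.
`K_L = ∂⁺_c ∘ Ψ_L ∘ ∂³_f` with a finitely supported stencil `Ψ_L` (symbol `R_L(z)/(L·z^L)`), the `L = 2, 3` instances
being `symbol_flux_two/three` with `R₂ = −1`, `R₃ = −(z² + 4z + 1)`.  (Existence only; the closed form
`−R_L = Σ_m C(min(m, 2L−4−m)+3, 3) z^m` and `|R_L(1)|/L = L(L²−1)/12` are [script, `L ≤ 16`].) [folklore] -/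
theorem defectSymbol_factor (L : ℕ) :
    ∃ RL : S[X], blockSymbol L * (C ((L : S) ^ 2) * X ^ (L - 1) * (X - 1) ^ 2 - (X ^ L - 1) ^ 2)
      = (X ^ L - 1) * (X - 1) ^ 3 * RL := by
  obtain ⟨RL, hRL⟩ := sq_dvd_blockSymbol (S := S) L
  have hgeom : (X : S[X]) ^ L - 1 = (X - 1) * blockSymbol L := by
    rw [blockSymbol, mul_comm, geom_sum_mul]
  refine ⟨RL, ?_⟩
  rw [hgeom, map_one] at *
  have : C ((L : S) ^ 2) * X ^ (L - 1) * (X - 1) ^ 2 - ((X - 1) * blockSymbol L) ^ 2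
      = (X - 1) ^ 2 * (C ((L : S) ^ 2) * X ^ (L - 1) - blockSymbol L ^ 2) := by ring
  rw [this, hRL]
  ring

end SymbolGeneralL

/-! ## §3  Two elementary sums: the inverse-square tail and the harmonic sum with a core -/
section Sums

/-- Inverse-square tail: `Σ_{r=m}^{M} r^{−2} ≤ 2/m` for `m ≥ 1` (Mathlib's `sum_Ioo_inv_sq_le`). [folklore] -/
theorem sum_inv_sq_Icc_le (m M : ℕ) (hm : 1 ≤ m) :
    ∑ r ∈ Icc m M, ((r : ℝ) ^ 2)⁻¹ ≤ 2 / (m : ℝ) := by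
  have h := sum_Ioo_inv_sq_le (α := ℝ) (m - 1) (M + 1)
  have hI : Icc m M = Ioo (m - 1) (M + 1) := by
    ext r
    simp only [mem_Icc, mem_Ioo]
    omega
  have hm' : ((m - 1 : ℕ) : ℝ) + 1 = m := by
    rw [Nat.cast_sub hm]
    push_cast
    ring
  rw [hI, ← hm']
  exact h

/-- Harmonic sum with a core: `Σ_{t=0}^{T} 1/max(1,t) ≤ 2 + log T`. [folklore] -/
theorem sum_inv_max_le (T : ℕ) :
    ∑ t ∈ range (T + 1), (max 1 (t : ℝ))⁻¹ ≤ 2 + Real.log T := by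
  rw [Finset.range_eq_Ico, Finset.sum_eq_sum_Ico_succ_bot (Nat.succ_pos T)]
  have h0 : (max 1 ((0 : ℕ) : ℝ))⁻¹ = 1 := by simp
  rw [h0]
  have hIcc : Ico 1 (T + 1) = Icc 1 T := by
    ext r; simp only [mem_Ico, mem_Icc]; omega
  have hrest : ∑ t ∈ Ico 1 (T + 1), (max 1 (t : ℝ))⁻¹ = ∑ t ∈ Icc 1 T, ((t : ℝ))⁻¹ := by
    rw [hIcc]
    refine sum_congr rfl fun t ht => ?_
    have h1 : (1 : ℝ) ≤ t := by exact_mod_cast (mem_Icc.1 ht).1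
    rw [max_eq_right h1]
  rw [hrest]
  have hharm : ∑ r ∈ Icc 1 T, ((r : ℝ))⁻¹ ≤ 1 + Real.log T := by
    have h := harmonic_le_one_add_log T
    simp_rw [harmonic_eq_sum_Icc, Rat.cast_sum, Rat.cast_inv, Rat.cast_natCast] at h
    exact h
  linarith

end Sums

/-! ## §4a  The second-difference Green kernel `∇G∇*` from per-slice operator data (exponent `p = d`) -/
section SecondDifferenceKernel

open Literature.MathematicalPhysics.QuantumFieldTheory.Balaban1983to89.T4SliceTelescoping
  (sandwich_pointwise profile_of_slices core_of_slices sliceConst)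

/-- Bookkeeping of the slice constant with ONE difference on each outer factor: `α ≤ C_A·s` (row of `∇G⁽ʲ⁾`, B9
(3.42) item 2 TYPE), `β ≤ C_B·s` (column of `G⁽ʲ⁺¹⁾∇*`, item 3 TYPE), `π₀ ≤ C_P/s^{d+2}` (block projection [model])
⇒ `α·β·π₀ ≤ C_A C_B C_P/s^d` — exponent `p = d`, one better than the gradient kernel's `d − 1`
(`T4SliceTelescoping.slice_const_le`). [folklore] -/
theorem slice_const_le₂ {CA CB CP s α β π₀ : ℝ} {d : ℕ} (hs : 0 < s) (hCA : 0 ≤ CA) (hCB : 0 ≤ CB)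
    (hβ0 : 0 ≤ β) (hπ0 : 0 ≤ π₀) (hα : α ≤ CA * s) (hβ : β ≤ CB * s) (hπ : π₀ ≤ CP / s ^ (d + 2)) :
    α * β * π₀ ≤ CA * CB * CP / s ^ d := by
  have hs0 : s ≠ 0 := hs.ne'
  have hCAs : 0 ≤ CA * s := mul_nonneg hCA hs.le
  have h1 : α * β ≤ (CA * s) * (CB * s) := mul_le_mul hα hβ hβ0 hCAs
  have h2 : α * β * π₀ ≤ (CA * s) * (CB * s) * (CP / s ^ (d + 2)) :=
    mul_le_mul h1 hπ hπ0 (mul_nonneg hCAs (mul_nonneg hCB hs.le))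
  have hsd : s ^ (d + 2) = s ^ 2 * s ^ d := by rw [← pow_add]; congr 1; omega
  calc α * β * π₀ ≤ (CA * s) * (CB * s) * (CP / s ^ (d + 2)) := h2
    _ = CA * CB * CP / s ^ d := by rw [hsd]; field_simp

/-- **One slice of `∇G∇*` from operator data at scale `L^{j+1}`** (`sandwich_pointwise` + `slice_const_le₂`):
weighted row bound `α` of `A = ∇G⁽ʲ⁾`, weighted pointwise bound `π₀` of `P = K_j − K_{j+1}`, weighted column bound `β`
of `B = G⁽ʲ⁺¹⁾∇*` ⟹ `|(A·P·B)(x,y)| ≤ C_A C_B C_P·e^{−δρ/L^{j+1}}/(L^{j+1})^d`.  Hypothesis SHAPES of printed TYPE per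
scale (B9 Thm 3.1 (3.42) items 2–3, Thm 3.3; (3.49)); nothing of Bałaban's is asserted. [folklore] -/
theorem slice_bound_of_operatorData₂ {X : Type*} [Fintype X] [DecidableEq X] (A P B : Matrix X X ℝ)
    (ρ : X → X → ℝ) {δ L CA CB CP α β π₀ : ℝ} {d : ℕ} (j : ℕ) (hL : 0 < L) (hδ : 0 ≤ δ) (hCA : 0 ≤ CA)
    (hCB : 0 ≤ CB) (htri : ∀ x z w y, ρ x y ≤ ρ x z + ρ z w + ρ w y)
    (hA : ∀ x, ∑ z, |A x z| * Real.exp (δ * (ρ x z / L ^ (j + 1))) ≤ α)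
    (hP : ∀ z w, |P z w| * Real.exp (δ * (ρ z w / L ^ (j + 1))) ≤ π₀)
    (hB : ∀ y, ∑ w, |B w y| * Real.exp (δ * (ρ w y / L ^ (j + 1))) ≤ β)
    (hα : α ≤ CA * L ^ (j + 1)) (hβ : β ≤ CB * L ^ (j + 1)) (hπ : π₀ ≤ CP / (L ^ (j + 1)) ^ (d + 2)) :
    ∀ x y, |(A * P * B) x y|
      ≤ CA * CB * CP * (Real.exp (-(δ * (ρ x y / L ^ (j + 1)))) / (L ^ (j + 1)) ^ d) := by
  intro x y
  have hs : 0 < L ^ (j + 1) := pow_pos hL _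
  have h := sandwich_pointwise A P B ρ hs hδ htri hA hP hB x y
  have hE : ∀ u v, 0 < Real.exp (δ * (ρ u v / L ^ (j + 1))) := fun u v => Real.exp_pos _
  have hπ0 : 0 ≤ π₀ := le_trans (mul_nonneg (abs_nonneg _) (hE x x).le) (hP x x)
  have hβ0 : 0 ≤ β :=
    le_trans (Finset.sum_nonneg fun w _ => mul_nonneg (abs_nonneg _) (hE w y).le) (hB y)
  have hc := slice_const_le₂ hs hCA hCB hβ0 hπ0 hα hβ hπ
  calc |(A * P * B) x y| ≤ α * β * π₀ * Real.exp (-(δ * (ρ x y / L ^ (j + 1)))) := h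
    _ ≤ CA * CB * CP / (L ^ (j + 1)) ^ d * Real.exp (-(δ * (ρ x y / L ^ (j + 1)))) :=
        mul_le_mul_of_nonneg_right hc (Real.exp_pos _).le
    _ = CA * CB * CP * (Real.exp (-(δ * (ρ x y / L ^ (j + 1)))) / (L ^ (j + 1)) ^ d) := by ring

/-- **The two kernel hypotheses of `faceColumn_sum_le` from per-slice bounds with exponent `d`**: King's slice sum
(`T4SliceTelescoping.profile_of_slices` at `p = d`) gives `|Σ_{i<n} g i z w| ≤ C·K_{δ,d}/ρ^d` off the diagonal and
`core_of_slices` gives `≤ 2C` everywhere.  [model] `Σ_i g i = ∇G_f∇*` telescoped over the scales `j ≤ k + 1`. [folklore] -/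
theorem faceKernel_of_slices {X : Type*} (g : ℕ → X → X → ℝ) (ρ : X → X → ℕ) {L δ C : ℝ} {d : ℕ} (n : ℕ)
    (hL : 2 ≤ L) (hδ : 0 < δ) (hC : 0 ≤ C) (hd : 1 ≤ d)
    (hg : ∀ i < n, ∀ x y, |g i x y| ≤ C * (Real.exp (-(δ * ((ρ x y : ℝ) / L ^ i))) / (L ^ i) ^ d)) (z : X) :
    (∀ w, 1 ≤ ρ z w → |∑ i ∈ range n, g i z w| ≤ C * sliceConst δ d / (ρ z w : ℝ) ^ d) ∧
    (∀ w, |∑ i ∈ range n, g i z w| ≤ 2 * C) := by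
  refine ⟨fun w hw => ?_, fun w => ?_⟩
  · exact profile_of_slices g (fun x y => (ρ x y : ℝ)) n hL hδ hC hd hg z w (by exact_mod_cast hw)
  · exact core_of_slices g (fun x y => (ρ x y : ℝ)) n hL hδ.le hC hd (fun x y => Nat.cast_nonneg _) hg z w

end SecondDifferenceKernel

/-! ## §4  Third differences of the fine minimiser from the differentiated equation: a `1/dist` profile -/
section ThirdDifference

/-- **Column sum over the face skeleton with a `ρ^{−d}` kernel, seen from distance `t`.**  Sites `w ∈ F` indexed by an
integer radius `ρ w ≤ N` about the observation point `z`; shells `#{ρ = r} ≤ A·r^{d−2}` (`r ≥ 1`, a codimension-one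
skeleton); the core `{ρ = 0}` carries at most `e₀ ≥ 0`; `|h w| ≤ C/ρ^d` off the core; and NO site of `F` is closer than
`t` (`t ≤ ρ w`, i.e. `t = dist(z, F)`).  Then `Σ_{w∈F} |h w| ≤ (e₀ + 2AC)/max(1,t)`.  [model] Dictionary: `h w =
(∇G_f∇*)(z,w)` (a second-difference Green kernel, profile `|z − w|^{−d}` from `T4SliceTelescoping` with one difference on
each outer factor), `F` = the unit-face skeleton of the fine lattice. [folklore] -/
theorem faceColumn_sum_le {ι : Type*} (F : Finset ι) (ρ : ι → ℕ) (h : ι → ℝ) {N d t : ℕ} (hd : 2 ≤ d)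
    {A e₀ C : ℝ} (hA : 0 ≤ A) (hC : 0 ≤ C) (he : 0 ≤ e₀) (hρN : ∀ w ∈ F, ρ w ≤ N)
    (hcard : ∀ r : ℕ, 1 ≤ r → ((F.filter fun w => ρ w = r).card : ℝ) ≤ A * (r : ℝ) ^ (d - 2))
    (h0 : ∑ w ∈ F.filter (fun w => ρ w = 0), |h w| ≤ e₀)
    (hh : ∀ w ∈ F, 1 ≤ ρ w → |h w| ≤ C / (ρ w : ℝ) ^ d) (ht : ∀ w ∈ F, t ≤ ρ w) :
    ∑ w ∈ F, |h w| ≤ (e₀ + 2 * A * C) / max 1 (t : ℝ) := by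
  have hmax1 : (1 : ℝ) ≤ max 1 (t : ℝ) := le_max_left _ _
  have hmax0 : (0 : ℝ) < max 1 (t : ℝ) := by linarith
  -- fibre the sum over the radius r ∈ range (N+1), split off r = 0
  have hmaps : ∀ w ∈ F, ρ w ∈ range (N + 1) := fun w hw => mem_range.mpr (Nat.lt_succ_of_le (hρN w hw))
  rw [← sum_fiberwise_of_maps_to hmaps, Finset.range_eq_Ico, Finset.sum_eq_sum_Ico_succ_bot (Nat.succ_pos N)]
  -- the core: ≤ e₀, and empty when t ≥ 1
  have hcore : ∑ w ∈ F.filter (fun w => ρ w = 0), |h w| ≤ e₀ / max 1 (t : ℝ) := by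
    rcases Nat.eq_zero_or_pos t with rfl | htpos
    · simpa using h0
    · have hempty : F.filter (fun w => ρ w = 0) = ∅ := by
        refine filter_eq_empty_iff.mpr fun w hw h0w => ?_
        have := ht w hw
        omega
      rw [hempty, sum_empty]
      positivity
  -- each shell r ≥ 1: ≤ A C / r², and empty when r < t
  have hshell : ∀ r ∈ Ico 1 (N + 1), ∑ w ∈ F.filter (fun w => ρ w = r), |h w| ≤ A * C * ((r : ℝ) ^ 2)⁻¹ := by
    intro r hr
    have hr1 : 1 ≤ r := (mem_Ico.mp hr).1
    have hr0 : (0 : ℝ) < r := by exact_mod_cast hr1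
    calc ∑ w ∈ F.filter (fun w => ρ w = r), |h w|
        ≤ ∑ w ∈ F.filter (fun w => ρ w = r), C / (r : ℝ) ^ d := by
          refine sum_le_sum fun w hw => ?_
          obtain ⟨hwF, hwr⟩ := mem_filter.mp hw
          have := hh w hwF (hwr ▸ hr1)
          rwa [hwr] at this
      _ = ((F.filter fun w => ρ w = r).card : ℝ) * (C / (r : ℝ) ^ d) := by rw [sum_const, nsmul_eq_mul]
      _ ≤ A * (r : ℝ) ^ (d - 2) * (C / (r : ℝ) ^ d) :=
          mul_le_mul_of_nonneg_right (hcard r hr1) (by positivity)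
      _ = A * C * ((r : ℝ) ^ 2)⁻¹ := by
          have hsplit : (r : ℝ) ^ d = (r : ℝ) ^ (d - 2) * (r : ℝ) ^ 2 := by
            rw [← pow_add, Nat.sub_add_cancel hd]
          rw [hsplit]
          field_simp
  have hzero : ∀ r ∈ Ico 1 (N + 1), ∑ w ∈ F.filter (fun w => ρ w = r), |h w| ≠ 0 → t ≤ r := by
    intro r _ hne
    by_contra hlt
    apply hne
    have hempty : F.filter (fun w => ρ w = r) = ∅ := by
      refine filter_eq_empty_iff.mpr fun w hw hwr => ?_
      have := ht w hw
      omega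
    rw [hempty, sum_empty]
  have hsub : (Ico 1 (N + 1)).filter (fun r => t ≤ r) ⊆ Icc (max 1 t) N := by
    intro r hr
    rw [mem_filter, mem_Ico] at hr
    rw [mem_Icc]
    omega
  have htail : ∑ r ∈ Ico 1 (N + 1), ∑ w ∈ F.filter (fun w => ρ w = r), |h w|
      ≤ A * C * (2 / max 1 (t : ℝ)) := by
    rw [← sum_filter_of_ne hzero]
    calc ∑ r ∈ (Ico 1 (N + 1)).filter (fun r => t ≤ r), ∑ w ∈ F.filter (fun w => ρ w = r), |h w|
        ≤ ∑ r ∈ (Ico 1 (N + 1)).filter (fun r => t ≤ r), A * C * ((r : ℝ) ^ 2)⁻¹ :=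
          sum_le_sum fun r hr => hshell r (mem_filter.1 hr).1
      _ ≤ ∑ r ∈ Icc (max 1 t) N, A * C * ((r : ℝ) ^ 2)⁻¹ :=
          sum_le_sum_of_subset_of_nonneg hsub fun r _ _ => by positivity
      _ = A * C * ∑ r ∈ Icc (max 1 t) N, ((r : ℝ) ^ 2)⁻¹ := by rw [← mul_sum]
      _ ≤ A * C * (2 / ((max 1 t : ℕ) : ℝ)) :=
          mul_le_mul_of_nonneg_left (sum_inv_sq_Icc_le (max 1 t) N (le_max_left _ _)) (mul_nonneg hA hC)
      _ = A * C * (2 / max 1 (t : ℝ)) := by rw [Nat.cast_max, Nat.cast_one]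
  calc ∑ w ∈ F.filter (fun w => ρ w = 0), |h w|
        + ∑ r ∈ Ico 1 (N + 1), ∑ w ∈ F.filter (fun w => ρ w = r), |h w|
      ≤ e₀ / max 1 (t : ℝ) + A * C * (2 / max 1 (t : ℝ)) := add_le_add hcore htail
    _ = (e₀ + 2 * A * C) / max 1 (t : ℝ) := by
        field_simp

/-- **Third differences of the fine minimiser: the `1/dist` profile.**  The differentiated (massless) minimiser equation
`Δ_f(∂_μU_{k+1}) = ∂_μ(Q₁*λ) =: ν_μ` makes `∂_μU_{k+1}` the potential of a SINGLE LAYER `ν_μ` supported on the unit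
faces `F` normal to `μ`, of density `|ν_μ| ≤ ν̂ ≤ 2·sup|λ|` (the multiplier's jumps); two more differences give
`∂³U(z) = Σ_{w∈F} h(z,w)·ν(w)` with a second-difference Green kernel `h`.  With the data of `faceColumn_sum_le`:
`|Σ_{w∈F} h w·ν w| ≤ ν̂·(e₀ + 2AC)/max(1, dist(z,F))`.  [model] Exact in the flat massless model (differences commute
with `Δ_f`); the covariant corrections are the readings (β), (γ) of the module docstring. [folklore] -/
theorem thirdDiff_le {ι : Type*} (F : Finset ι) (ρ : ι → ℕ) (h ν : ι → ℝ) {N d t : ℕ} (hd : 2 ≤ d)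
    {A e₀ C νmax : ℝ} (hA : 0 ≤ A) (hC : 0 ≤ C) (he : 0 ≤ e₀) (hρN : ∀ w ∈ F, ρ w ≤ N)
    (hcard : ∀ r : ℕ, 1 ≤ r → ((F.filter fun w => ρ w = r).card : ℝ) ≤ A * (r : ℝ) ^ (d - 2))
    (h0 : ∑ w ∈ F.filter (fun w => ρ w = 0), |h w| ≤ e₀)
    (hh : ∀ w ∈ F, 1 ≤ ρ w → |h w| ≤ C / (ρ w : ℝ) ^ d) (ht : ∀ w ∈ F, t ≤ ρ w)
    (hν0 : 0 ≤ νmax) (hν : ∀ w ∈ F, |ν w| ≤ νmax) :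
    |∑ w ∈ F, h w * ν w| ≤ νmax * ((e₀ + 2 * A * C) / max 1 (t : ℝ)) := by
  have hcol := faceColumn_sum_le F ρ h hd hA hC he hρN hcard h0 hh ht
  calc |∑ w ∈ F, h w * ν w| ≤ ∑ w ∈ F, |h w * ν w| := abs_sum_le_sum_abs _ _
    _ = ∑ w ∈ F, |h w| * |ν w| := by simp_rw [abs_mul]
    _ ≤ ∑ w ∈ F, |h w| * νmax :=
        sum_le_sum fun w hw => mul_le_mul_of_nonneg_left (hν w hw) (abs_nonneg _)
    _ = (∑ w ∈ F, |h w|) * νmax := by rw [sum_mul]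
    _ ≤ (e₀ + 2 * A * C) / max 1 (t : ℝ) * νmax := mul_le_mul_of_nonneg_right hcol hν0
    _ = νmax * ((e₀ + 2 * A * C) / max 1 (t : ℝ)) := mul_comm _ _

end ThirdDifference

/-! ## §4c  From third differences to fluxes: the stencil transfer -/
section StencilTransfer

/-- `1/max(1,t′) ≤ (1 + w₀)/max(1,t)` whenever `t ≤ t′ + w₀` (`w₀ ≥ 0`): moving the observation point by at most the
stencil width `w₀` costs the factor `1 + w₀` in a `1/dist` profile. [folklore] -/
theorem inv_max_le_of_le_add {t t' w₀ : ℝ} (ht' : 0 ≤ t') (hw : 0 ≤ w₀) (h : t ≤ t' + w₀) :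
    (max 1 t')⁻¹ ≤ (1 + w₀) / max 1 t := by
  have hm' : (0 : ℝ) < max 1 t' := lt_of_lt_of_le one_pos (le_max_left _ _)
  have hm : (0 : ℝ) < max 1 t := lt_of_lt_of_le one_pos (le_max_left _ _)
  rw [inv_eq_one_div, div_le_div_iff₀ hm' hm, one_mul]
  have h1 : max 1 t ≤ max 1 (t' + w₀) := max_le_max le_rfl h
  have h2 : max 1 (t' + w₀) ≤ (1 + w₀) * max 1 t' := by
    rcases le_or_gt t' 1 with ht1 | ht1
    · rw [max_eq_left ht1]; exact max_le (by linarith) (by linarith)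
    · rw [max_eq_right ht1.le]; exact max_le (by nlinarith) (by nlinarith)
  linarith

/-- **Stencil transfer.**  A flux `Σ_z ψ(y,z)·D(z)` built from third differences `|D z| ≤ Θ/max(1, t z)` with a
summable stencil `Σ_z |ψ y z| ≤ Ψ₁` supported within distance `w₀` (`t y ≤ t z + w₀` on the support) satisfies
`|Σ_z ψ(y,z)D(z)| ≤ Ψ₁Θ(1 + w₀)/max(1, t y)`.  [model] Dictionary: `ψ = q_⊥μ ⊗ Ψ_μ` (total weight
`Ψ₁ = ‖Ψ_L‖₁ = L(L²−1)/12` per transverse-mean-normalised block), `D = ∂³_{f,μ}U_{k+1}`, `Θ = ν̂(e₀ + 2AC)` of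
`thirdDiff_le`, `w₀` = the stencil's reach in units of `t`. [folklore] -/
theorem flux_le_of_stencil {κ : Type*} (S : Finset κ) (ψ D : κ → ℝ) (tz : κ → ℝ) {ty w₀ Ψ₁ Θ : ℝ}
    (hΘ : 0 ≤ Θ) (hw : 0 ≤ w₀) (htz : ∀ z ∈ S, 0 ≤ tz z) (hreach : ∀ z ∈ S, ψ z ≠ 0 → ty ≤ tz z + w₀)
    (hψ : ∑ z ∈ S, |ψ z| ≤ Ψ₁) (hD : ∀ z ∈ S, |D z| ≤ Θ / max 1 (tz z)) :
    |∑ z ∈ S, ψ z * D z| ≤ Ψ₁ * Θ * (1 + w₀) / max 1 ty := by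
  have hm : (0 : ℝ) < max 1 ty := lt_of_lt_of_le one_pos (le_max_left _ _)
  have hkey : ∀ z ∈ S, |ψ z * D z| ≤ |ψ z| * (Θ * (1 + w₀) / max 1 ty) := by
    intro z hz
    rw [abs_mul]
    rcases eq_or_ne (ψ z) 0 with h0 | h0
    · simp [h0]
    · refine mul_le_mul_of_nonneg_left ?_ (abs_nonneg _)
      calc |D z| ≤ Θ / max 1 (tz z) := hD z hz
        _ = Θ * (max 1 (tz z))⁻¹ := div_eq_mul_inv _ _
        _ ≤ Θ * ((1 + w₀) / max 1 ty) :=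
            mul_le_mul_of_nonneg_left (inv_max_le_of_le_add (htz z hz) hw (hreach z hz h0)) hΘ
        _ = Θ * (1 + w₀) / max 1 ty := by ring
  calc |∑ z ∈ S, ψ z * D z| ≤ ∑ z ∈ S, |ψ z * D z| := abs_sum_le_sum_abs _ _
    _ ≤ ∑ z ∈ S, |ψ z| * (Θ * (1 + w₀) / max 1 ty) := sum_le_sum hkey
    _ = (∑ z ∈ S, |ψ z|) * (Θ * (1 + w₀) / max 1 ty) := by rw [sum_mul]
    _ ≤ Ψ₁ * (Θ * (1 + w₀) / max 1 ty) := mul_le_mul_of_nonneg_right hψ (by positivity)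
    _ = Ψ₁ * Θ * (1 + w₀) / max 1 ty := by ring

end StencilTransfer

/-! ## §5  The stratified flux sum: double-layer rows × a `1/dist` flux = (row constant)·(2 + log) -/
section Stratified

/-- **Stratified flux bookkeeping.**  Index the flux sites `y ∈ Y` by their integer distance `lev y ≤ T` to the face
skeleton.  If every LEVEL SET `{lev = t}` (a double layer about the skeleton) has gradient-of-Green row sum
`Σ_{lev y = t} |g y| ≤ DL` (the double-layer constant of `T4TwoSpacingDefect.layer_sum_le`, uniformly in `t`), and the
flux has the profile `|f y| ≤ Φ/max(1, lev y)`, then `Σ_y |g y|·|f y| ≤ DL·Φ·(2 + log T)`.  [model] `g y =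
(∇_cG_c)(x,y)`, `f = flux_μ`, `T ≤ L^k` = the coarse diameter of a unit cube: ONE logarithm from the `1/dist`
profile on top of the one inside `DL`. [folklore] -/
theorem stratified_sum_le {ι : Type*} (Y : Finset ι) (lev : ι → ℕ) (g f : ι → ℝ) {T : ℕ} {DL Φ : ℝ}
    (hΦ : 0 ≤ Φ) (hlevT : ∀ y ∈ Y, lev y ≤ T)
    (hrow : ∀ t : ℕ, ∑ y ∈ Y.filter (fun y => lev y = t), |g y| ≤ DL)
    (hf : ∀ y ∈ Y, |f y| ≤ Φ / max 1 (lev y : ℝ)) :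
    ∑ y ∈ Y, |g y| * |f y| ≤ DL * Φ * (2 + Real.log T) := by
  have hDL : 0 ≤ DL := le_trans (sum_nonneg fun _ _ => abs_nonneg _) (hrow 0)
  have hmaps : ∀ y ∈ Y, lev y ∈ range (T + 1) := fun y hy => mem_range.mpr (Nat.lt_succ_of_le (hlevT y hy))
  rw [← sum_fiberwise_of_maps_to hmaps]
  have hlev : ∀ t ∈ range (T + 1),
      ∑ y ∈ Y.filter (fun y => lev y = t), |g y| * |f y| ≤ DL * (Φ * (max 1 (t : ℝ))⁻¹) := by
    intro t _
    calc ∑ y ∈ Y.filter (fun y => lev y = t), |g y| * |f y|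
        ≤ ∑ y ∈ Y.filter (fun y => lev y = t), |g y| * (Φ * (max 1 (t : ℝ))⁻¹) := by
          refine sum_le_sum fun y hy => ?_
          obtain ⟨hyY, hyt⟩ := mem_filter.mp hy
          refine mul_le_mul_of_nonneg_left ?_ (abs_nonneg _)
          have := hf y hyY
          rw [hyt] at this
          simpa [div_eq_mul_inv] using this
      _ = (∑ y ∈ Y.filter (fun y => lev y = t), |g y|) * (Φ * (max 1 (t : ℝ))⁻¹) := by rw [sum_mul]
      _ ≤ DL * (Φ * (max 1 (t : ℝ))⁻¹) := mul_le_mul_of_nonneg_right (hrow t) (by positivity)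
  calc ∑ t ∈ range (T + 1), ∑ y ∈ Y.filter (fun y => lev y = t), |g y| * |f y|
      ≤ ∑ t ∈ range (T + 1), DL * (Φ * (max 1 (t : ℝ))⁻¹) := sum_le_sum hlev
    _ = DL * Φ * ∑ t ∈ range (T + 1), (max 1 (t : ℝ))⁻¹ := by rw [mul_sum]; exact sum_congr rfl fun _ _ => by ring
    _ ≤ DL * Φ * (2 + Real.log T) := mul_le_mul_of_nonneg_left (sum_inv_max_le T) (mul_nonneg hDL hΦ)

/-- The propagated truncation error at a point: `|Σ_y g y·f y| ≤ DL·Φ·(2 + log T)` (signs discarded — no dipole or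
face-interior cancellation is used; that cancellation is exactly the typed (W2)). [folklore] -/
theorem stratified_abs_sum_le {ι : Type*} (Y : Finset ι) (lev : ι → ℕ) (g f : ι → ℝ) {T : ℕ} {DL Φ : ℝ}
    (hΦ : 0 ≤ Φ) (hlevT : ∀ y ∈ Y, lev y ≤ T)
    (hrow : ∀ t : ℕ, ∑ y ∈ Y.filter (fun y => lev y = t), |g y| ≤ DL)
    (hf : ∀ y ∈ Y, |f y| ≤ Φ / max 1 (lev y : ℝ)) :
    |∑ y ∈ Y, g y * f y| ≤ DL * Φ * (2 + Real.log T) := by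
  calc |∑ y ∈ Y, g y * f y| ≤ ∑ y ∈ Y, |g y * f y| := abs_sum_le_sum_abs _ _
    _ = ∑ y ∈ Y, |g y| * |f y| := by simp_rw [abs_mul]
    _ ≤ DL * Φ * (2 + Real.log T) := stratified_sum_le Y lev g f hΦ hlevT hrow hf

end Stratified

/-! ## §6  The re-cut wall `FluxSized` and its consumers by name, at every rate `L^{−a}` -/
section Wall

/-- **The flux-form wall** (the (115)-currency consistency input WITHOUT face transmission).  Per scale `k` and datum
`V ∈ dom`: (F1) the local correction reading is bounded by (double-layer constant) × (flux size) × `(2 + k·log L)`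
(`stratified_abs_sum_le` with `T ≤ L^k`) plus a remainder `blk` (everything not in flux form: the slab-mean
normalisation term `G_c(1 − C₁)λ`, zero for block means, and — for the covariant objects — the curvature remainders
(α)(β)(γ) of the module docstring); (F2) the double-layer constant carries at most one logarithm, `dl ≤ C_DL(1 + k log L)`
(`T4SliceTelescoping.consistencyT2_of_slices`: per-scale operator data for `∇G_c`); (F3) the flux size is linear in the
multiplier scale, `0 ≤ φ ≤ C_Φ·λ̂` (`thirdDiff_le` + `flux_le_of_stencil`: per-scale operator data for `∇G_f∇*`);
(F4) the remainder is at most log²-large, `0 ≤ blk ≤ C_B(1 + k log L)²·λ̂`; (F5) the multiplier is third-order small,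
`0 ≤ λ̂ ≤ B·η³` (clause (T5) of `T4TwoSpacingDefect.ConsistencySized`, printed TYPE).  Compare `ConsistencySized`: its
clauses (T3)/(T4) (single logarithm = face transmission (W2)) are REPLACED by (F1)/(F3)/(F4) (no transmission, one
more logarithm).  A predicate — never used as a fact. [model] [folklore] -/
def FluxSized {ι : Type*} (dom : Set ι) (z dl phi blk lam : ℕ → ι → ℝ) (L CDL CΦ CB B : ℝ) : Prop :=
  (∀ k : ℕ, ∀ V ∈ dom, z k V ≤ dl k V * phi k V * (2 + k * Real.log L) + blk k V) ∧
  (∀ k : ℕ, ∀ V ∈ dom, dl k V ≤ CDL * (1 + k * Real.log L)) ∧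
  (∀ k : ℕ, ∀ V ∈ dom, 0 ≤ phi k V ∧ phi k V ≤ CΦ * lam k V) ∧
  (∀ k : ℕ, ∀ V ∈ dom, 0 ≤ blk k V ∧ blk k V ≤ CB * (1 + k * Real.log L) ^ 2 * lam k V) ∧
  (∀ k : ℕ, ∀ V ∈ dom, 0 ≤ lam k V ∧ lam k V ≤ B * (L⁻¹ ^ k) ^ 3)

/-- **(F1) from kernel data.**  If at every scale the reading `z k V` is dominated at some observation point `x` by
`Σ_y |g(x,y)|·|f(y)|` (the propagated flux form, `green_mul_fluxForm`), the level-set rows of `g` are bounded by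
`dl k V`, the flux by `phi k V/max(1, lev y)`, and the levels by `T_k ≤ L^k`, then the flux part of clause (F1)
holds (add the remainder `blk` on both sides for (F1) itself). [folklore] -/
theorem fluxF1_of_kernels {ι : Type*} {dom : Set ι} {X : ℕ → Type*} (Y : ∀ k, Finset (X k))
    (lev : ∀ k, X k → ℕ) (T : ℕ → ℕ) (g : ∀ k, ι → X k → X k → ℝ) (f : ∀ k, ι → X k → ℝ)
    (z dl phi : ℕ → ι → ℝ) {L : ℝ} (hL : 1 ≤ L) (hT : ∀ k, (T k : ℝ) ≤ L ^ k)
    (hlev : ∀ k, ∀ y ∈ Y k, lev k y ≤ T k)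
    (hz : ∀ k, ∀ V ∈ dom, ∃ x : X k, z k V ≤ ∑ y ∈ Y k, |g k V x y| * |f k V y|)
    (hrow : ∀ k, ∀ V ∈ dom, ∀ x : X k, ∀ t : ℕ,
      ∑ y ∈ (Y k).filter (fun y => lev k y = t), |g k V x y| ≤ dl k V)
    (hphi : ∀ k, ∀ V ∈ dom, 0 ≤ phi k V)
    (hf : ∀ k, ∀ V ∈ dom, ∀ y ∈ Y k, |f k V y| ≤ phi k V / max 1 (lev k y : ℝ)) :
    ∀ k, ∀ V ∈ dom, z k V ≤ dl k V * phi k V * (2 + k * Real.log L) := by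
  intro k V hV
  obtain ⟨x, hx⟩ := hz k V hV
  have hs := stratified_sum_le (Y k) (lev k) (g k V x) (f k V) (hphi k V hV) (hlev k) (hrow k V hV x) (hf k V hV)
  have hDL : 0 ≤ dl k V := le_trans (sum_nonneg fun _ _ => abs_nonneg _) (hrow k V hV x 0)
  have hlog : Real.log (T k) ≤ k * Real.log L := by
    rcases Nat.eq_zero_or_pos (T k) with h0 | hpos
    · rw [h0, Nat.cast_zero, Real.log_zero]
      exact mul_nonneg (Nat.cast_nonneg k) (Real.log_nonneg hL)
    · calc Real.log (T k) ≤ Real.log (L ^ k) := Real.log_le_log (by exact_mod_cast hpos) (hT k)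
        _ = k * Real.log L := by rw [Real.log_pow]
  calc z k V ≤ ∑ y ∈ Y k, |g k V x y| * |f k V y| := hx
    _ ≤ dl k V * phi k V * (2 + Real.log (T k)) := hs
    _ ≤ dl k V * phi k V * (2 + k * Real.log L) :=
        mul_le_mul_of_nonneg_left (by linarith) (mul_nonneg hDL (hphi k V hV))

/-- **The flux-form wall ⇒ the size of the source at log².**  `z ≤ (2·C_DL·C_Φ + C_B)·B·(1 + k log L)²·η³`. [folklore] -/
theorem flux_clause1 {ι : Type*} {dom : Set ι} {z dl phi blk lam : ℕ → ι → ℝ} {L CDL CΦ CB B : ℝ}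
    (h : FluxSized dom z dl phi blk lam L CDL CΦ CB B) (hL : 1 ≤ L) (hCDL : 0 ≤ CDL) (hCΦ : 0 ≤ CΦ)
    (hCB : 0 ≤ CB) :
    ∀ k, ∀ V ∈ dom, z k V ≤ (2 * CDL * CΦ + CB) * B * (1 + k * Real.log L) ^ 2 * (L⁻¹ ^ k) ^ 3 := by
  obtain ⟨h1, h2, h3, h4, h5⟩ := h
  intro k V hV
  set y : ℝ := (k : ℝ) * Real.log L with hydef
  set η3 : ℝ := (L⁻¹ ^ k) ^ 3 with hη3def
  have hy : 0 ≤ y := mul_nonneg (Nat.cast_nonneg k) (Real.log_nonneg hL)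
  obtain ⟨hphi0, hphi⟩ := h3 k V hV
  obtain ⟨_, hblk⟩ := h4 k V hV
  obtain ⟨hlam0, hlam⟩ := h5 k V hV
  have hc1 : 0 ≤ CDL * (1 + y) := mul_nonneg hCDL (by linarith)
  have hA : dl k V * phi k V ≤ CDL * (1 + y) * (CΦ * (B * η3)) := by
    calc dl k V * phi k V ≤ CDL * (1 + y) * phi k V := mul_le_mul_of_nonneg_right (h2 k V hV) hphi0
      _ ≤ CDL * (1 + y) * (CΦ * (B * η3)) :=
          mul_le_mul_of_nonneg_left (hphi.trans (mul_le_mul_of_nonneg_left hlam hCΦ)) hc1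
  have hBη : 0 ≤ B * η3 := hlam0.trans hlam
  have hP : 0 ≤ CDL * (1 + y) * (CΦ * (B * η3)) := mul_nonneg hc1 (mul_nonneg hCΦ hBη)
  have hB' : blk k V ≤ CB * (1 + y) ^ 2 * (B * η3) :=
    hblk.trans (mul_le_mul_of_nonneg_left hlam (by positivity))
  calc z k V ≤ dl k V * phi k V * (2 + y) + blk k V := h1 k V hV
    _ ≤ CDL * (1 + y) * (CΦ * (B * η3)) * (2 + y) + CB * (1 + y) ^ 2 * (B * η3) :=
        add_le_add (mul_le_mul_of_nonneg_right hA (by linarith)) hB'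
    _ ≤ CDL * (1 + y) * (CΦ * (B * η3)) * (2 * (1 + y)) + CB * (1 + y) ^ 2 * (B * η3) := by
        have h22 : 2 + y ≤ 2 * (1 + y) := by linarith
        have := mul_le_mul_of_nonneg_left h22 hP
        linarith
    _ = (2 * CDL * CΦ + CB) * B * (1 + y) ^ 2 * η3 := by ring

/-- **Squared log absorption**: `(1 + k·log L)²·L^{−k} ≤ (e^{−b}/(1 − b))²·(L^{−a})^k` with `b = (1 + a)/2`, for
every `L ≥ 1`, `a < 1`, `k` — the second logarithm of the flux form costs a CONSTANT at every rate `L^{−a}`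
(`a = 1/2`: `(4e^{−3/4})² ≈ 3.57`; `a = 2/3`: `(6e^{−5/6})² ≈ 6.80`).  From `one_add_le_exp_mul` at `b`. [folklore] -/
theorem one_add_mul_log_sq_mul_pow_le_rpow {L a : ℝ} (hL : 1 ≤ L) (ha : a < 1) (k : ℕ) :
    (1 + k * Real.log L) ^ 2 * L⁻¹ ^ k
      ≤ (Real.exp (-((1 + a) / 2)) / (1 - (1 + a) / 2)) ^ 2 * (L ^ (-a)) ^ k := by
  have hL0 : 0 < L := by linarith
  set b : ℝ := (1 + a) / 2 with hb
  have hb1 : b < 1 := by rw [hb]; linarith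
  set y : ℝ := k * Real.log L with hy
  set c : ℝ := Real.exp (-b) / (1 - b) with hc
  have hy0 : 0 ≤ y := mul_nonneg (Nat.cast_nonneg k) (Real.log_nonneg hL)
  have hpow : L⁻¹ ^ k = Real.exp (-y) := by
    rw [hy, Real.exp_neg, Real.exp_nat_mul, Real.exp_log hL0, inv_pow]
  have hrpow : (L ^ (-a)) ^ k = Real.exp (-a * y) := by
    rw [Real.rpow_def_of_pos hL0, ← Real.exp_nat_mul, hy]
    congr 1; ring
  have h1 : 1 + y ≤ c * Real.exp ((1 - b) * y) := one_add_le_exp_mul y b hb1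
  have h2 : (1 + y) ^ 2 ≤ (c * Real.exp ((1 - b) * y)) ^ 2 := pow_le_pow_left₀ (by linarith) h1 2
  have hexp : (Real.exp ((1 - b) * y)) ^ 2 * Real.exp (-y) = Real.exp (-a * y) := by
    rw [sq, ← Real.exp_add, ← Real.exp_add]; congr 1; rw [hb]; ring
  calc (1 + y) ^ 2 * L⁻¹ ^ k = (1 + y) ^ 2 * Real.exp (-y) := by rw [hpow]
    _ ≤ (c * Real.exp ((1 - b) * y)) ^ 2 * Real.exp (-y) :=
        mul_le_mul_of_nonneg_right h2 (Real.exp_pos _).le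
    _ = c ^ 2 * ((Real.exp ((1 - b) * y)) ^ 2 * Real.exp (-y)) := by ring
    _ = c ^ 2 * Real.exp (-a * y) := by rw [hexp]
    _ = c ^ 2 * (L ^ (-a)) ^ k := by rw [hrpow]

/-- The squared log constant, named: `c₂(a) = (e^{−(1+a)/2}/(1 − (1+a)/2))² = (2e^{−(1+a)/2}/(1 − a))²`. [folklore] -/
def logSqConst (a : ℝ) : ℝ := (Real.exp (-((1 + a) / 2)) / (1 - (1 + a) / 2)) ^ 2

/-- The squared log constant is positive for `a < 1`. [folklore] -/
theorem logSqConst_pos (a : ℝ) (ha : a < 1) : 0 < logSqConst a := by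
  unfold logSqConst
  exact pow_pos (div_pos (Real.exp_pos _) (by linarith)) 2

/-- **OSC from the flux form at ANY rate `L^{−a}`, `a < 1`.**  Source size at log² (`flux_clause1`) + the boundary
term and the oscillation readings exactly as in `T4OneStepFactorisation.oneStepCorrectionRate_of_lrr_rpow` ⟹
`OneStepCorrectionRate dom osc ((1 + C_D)(1 + C_Π)·C_Z·B·c₂(a) + B₀C_R) (L^{−a})`. [folklore] -/
theorem oneStepCorrectionRate_of_flux_rpow {ι : Type*} {dom : Set ι} (z t osc : ℕ → ι → ℝ)
    {L a CP CD CZ B B0 CR : ℝ} (hL : 1 ≤ L) (ha : a < 1) (hCP : 0 ≤ CP) (hCD : 0 ≤ CD) (hCZ : 0 ≤ CZ)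
    (hB : 0 ≤ B) (hB0 : 0 ≤ B0) (hCR : 0 ≤ CR)
    (hz : ∀ k, ∀ V ∈ dom, z k V ≤ CZ * B * (1 + k * Real.log L) ^ 2 * (L⁻¹ ^ k) ^ 3)
    (ht : ∀ k, ∀ V ∈ dom, t k V ≤ B0 * CR * L⁻¹ ^ k)
    (hosc : ∀ k, ∀ V ∈ dom, osc k V ≤ (1 + CD) * (1 + CP) * z k V / (L⁻¹ ^ k) ^ 2 + t k V) :
    OneStepCorrectionRate dom osc
      ((1 + CD) * (1 + CP) * CZ * B * logSqConst a + B0 * CR) (L ^ (-a)) := by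
  intro k V hV
  set η : ℝ := L⁻¹ ^ k with hη
  set ϑ : ℝ := (L ^ (-a)) ^ k with hϑ
  set c : ℝ := logSqConst a with hc
  have hL0 : 0 < L := by linarith
  have hη0 : 0 < η := by positivity
  have hc0 : 0 < c := logSqConst_pos a ha
  have hϑ0 : 0 ≤ ϑ := pow_nonneg (Real.rpow_nonneg hL0.le _) k
  have hηϑ : η ≤ ϑ := inv_pow_le_rpow_pow hL ha.le k
  have hlogϑ : (1 + k * Real.log L) ^ 2 * η ≤ c * ϑ := one_add_mul_log_sq_mul_pow_le_rpow hL ha k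
  have hzk := hz k V hV
  have htk := ht k V hV
  have hA : 0 ≤ (1 + CD) * (1 + CP) := by positivity
  have hZB : 0 ≤ CZ * B := by positivity
  have h1 : (1 + CD) * (1 + CP) * z k V / η ^ 2 ≤ (1 + CD) * (1 + CP) * CZ * B * c * ϑ := by
    rw [div_le_iff₀ (by positivity)]
    have h1a : z k V ≤ CZ * B * (c * ϑ) * η ^ 2 := by
      calc z k V ≤ CZ * B * (1 + k * Real.log L) ^ 2 * η ^ 3 := hzk
        _ = CZ * B * ((1 + k * Real.log L) ^ 2 * η) * η ^ 2 := by ring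
        _ ≤ CZ * B * (c * ϑ) * η ^ 2 :=
          mul_le_mul_of_nonneg_right (mul_le_mul_of_nonneg_left hlogϑ hZB) (by positivity)
    calc (1 + CD) * (1 + CP) * z k V ≤ (1 + CD) * (1 + CP) * (CZ * B * (c * ϑ) * η ^ 2) :=
          mul_le_mul_of_nonneg_left h1a hA
      _ = (1 + CD) * (1 + CP) * CZ * B * c * ϑ * η ^ 2 := by ring
  have h2 : t k V ≤ B0 * CR * ϑ := htk.trans (mul_le_mul_of_nonneg_left hηϑ (by positivity))
  calc osc k V ≤ (1 + CD) * (1 + CP) * z k V / η ^ 2 + t k V := hosc k V hV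
    _ ≤ (1 + CD) * (1 + CP) * CZ * B * c * ϑ + B0 * CR * ϑ := add_le_add h1 h2
    _ = ((1 + CD) * (1 + CP) * CZ * B * c + B0 * CR) * ϑ := by ring

/-- **The flux-form wall by name ⇒ OSC at any rate `L^{−a}`.**  `FluxSized` (consistency, flux form) + the boundary
term (T5) and the oscillation readings (I′)(I″) of `T4TwoSpacingDefect` as sized hypotheses ⟹
`OneStepCorrectionRate dom osc ((1 + C_D)(1 + C_Π)·(2C_DL C_Φ)·B·c₂(a) + B₀C_R) (L^{−a})`. [folklore] -/
theorem oneStepCorrectionRate_of_fluxSized_rpow {ι : Type*} {dom : Set ι}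
    {z dl phi blk lam t osc : ℕ → ι → ℝ} {L CDL CΦ CB B CP CD B0 CR : ℝ}
    (h : FluxSized dom z dl phi blk lam L CDL CΦ CB B) {a : ℝ}
    (hL : 1 ≤ L) (ha : a < 1) (hCDL : 0 ≤ CDL) (hCΦ : 0 ≤ CΦ) (hCB : 0 ≤ CB) (hCP : 0 ≤ CP) (hCD : 0 ≤ CD)
    (hB : 0 ≤ B) (hB0 : 0 ≤ B0) (hCR : 0 ≤ CR)
    (ht : ∀ k, ∀ V ∈ dom, t k V ≤ B0 * CR * L⁻¹ ^ k)
    (hosc : ∀ k, ∀ V ∈ dom, osc k V ≤ (1 + CD) * (1 + CP) * z k V / (L⁻¹ ^ k) ^ 2 + t k V) :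
    OneStepCorrectionRate dom osc
      ((1 + CD) * (1 + CP) * (2 * CDL * CΦ + CB) * B * logSqConst a + B0 * CR) (L ^ (-a)) :=
  oneStepCorrectionRate_of_flux_rpow z t osc hL ha hCP hCD (by positivity) hB hB0 hCR
    (flux_clause1 h hL hCDL hCΦ hCB) ht hosc

/-- Consumer-facing: `FluxSized` + reading / response / pairing ⟹ `T4EtaRateMin.LocalRate R C (L^{−a})`. [folklore] -/
theorem localRate_of_fluxSized_rpow {ι X : Type*} {R : Readings ι X}
    {z dl phi blk lam t osc nrm pair : ℕ → ι → ℝ} {L CDL CΦ CB B CP CD B0 CR Γ Λr ρ₂ a : ℝ}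
    (h : FluxSized R.dom z dl phi blk lam L CDL CΦ CB B)
    (hL : 1 ≤ L) (ha : a < 1) (hCDL : 0 ≤ CDL) (hCΦ : 0 ≤ CΦ) (hCB : 0 ≤ CB) (hCP : 0 ≤ CP) (hCD : 0 ≤ CD)
    (hB : 0 ≤ B) (hB0 : 0 ≤ B0) (hCR : 0 ≤ CR) (hΓ : 0 ≤ Γ) (hΛr : 0 ≤ Λr)
    (ht : ∀ k, ∀ V ∈ R.dom, t k V ≤ B0 * CR * L⁻¹ ^ k)
    (hosc : ∀ k, ∀ V ∈ R.dom, osc k V ≤ (1 + CD) * (1 + CP) * z k V / (L⁻¹ ^ k) ^ 2 + t k V)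
    (hread : ∀ k : ℕ, ∀ V ∈ R.dom, ∀ x : X,
      |R.loc (k + 1) V x - R.loc k V x| ≤ Λr * nrm k V + pair k V)
    (hresp : ∀ k : ℕ, ∀ V ∈ R.dom, nrm k V ≤ Γ * osc k V)
    (hpair : OneStepCorrectionRate R.dom pair ρ₂ (L ^ (-a))) :
    LocalRate R
      (Λr * Γ * ((1 + CD) * (1 + CP) * (2 * CDL * CΦ + CB) * B * logSqConst a + B0 * CR) + ρ₂) (L ^ (-a)) :=
  localRate_of_oneStep' nrm osc pair hΓ hΛr hread hresp
    (oneStepCorrectionRate_of_fluxSized_rpow h hL ha hCDL hCΦ hCB hCP hCD hB hB0 hCR ht hosc) hpair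

/-- **The flux-form wall by name ⇒ the node's shape by name, rate `L^{−a}`** (`0 < a < 1`, `L > 1`):
`FluxSized` + (T5) + (I′)(I″) + reading / response / pairing + "act = Σ_x loc, card X ≤ vol" ⟹
`T4EtaRateMin.NE3Shape R C (L^{−a})`.  This is the generation-7 form of the NE3 claim: the consistency input enters in
FLUX FORM, with no face-transmission hypothesis. [folklore] -/
theorem ne3Shape_of_fluxSized_rpow {ι X : Type*} [Fintype X] {R : Readings ι X}
    {z dl phi blk lam t osc nrm pair : ℕ → ι → ℝ} {L CDL CΦ CB B CP CD B0 CR Γ Λr ρ₂ a : ℝ}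
    (h : FluxSized R.dom z dl phi blk lam L CDL CΦ CB B)
    (hL : 1 < L) (ha0 : 0 < a) (ha : a < 1) (hCDL : 0 ≤ CDL) (hCΦ : 0 ≤ CΦ) (hCB : 0 ≤ CB) (hCP : 0 ≤ CP)
    (hCD : 0 ≤ CD) (hB : 0 ≤ B) (hB0 : 0 ≤ B0) (hCR : 0 ≤ CR) (hΓ : 0 ≤ Γ) (hΛr : 0 ≤ Λr) (hρ₂ : 0 ≤ ρ₂)
    (ht : ∀ k, ∀ V ∈ R.dom, t k V ≤ B0 * CR * L⁻¹ ^ k)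
    (hosc : ∀ k, ∀ V ∈ R.dom, osc k V ≤ (1 + CD) * (1 + CP) * z k V / (L⁻¹ ^ k) ^ 2 + t k V)
    (hact : ∀ k : ℕ, ∀ V ∈ R.dom, R.act k V = ∑ x, R.loc k V x) (hvol : (Fintype.card X : ℝ) ≤ R.vol)
    (hread : ∀ k : ℕ, ∀ V ∈ R.dom, ∀ x : X,
      |R.loc (k + 1) V x - R.loc k V x| ≤ Λr * nrm k V + pair k V)
    (hresp : ∀ k : ℕ, ∀ V ∈ R.dom, nrm k V ≤ Γ * osc k V)
    (hpair : OneStepCorrectionRate R.dom pair ρ₂ (L ^ (-a))) :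
    NE3Shape R
      (Λr * Γ * ((1 + CD) * (1 + CP) * (2 * CDL * CΦ + CB) * B * logSqConst a + B0 * CR) + ρ₂) (L ^ (-a)) := by
  have hloc := localRate_of_fluxSized_rpow h hL.le ha hCDL hCΦ hCB hCP hCD hB hB0 hCR hΓ hΛr ht hosc hread
    hresp hpair
  obtain ⟨h0, h1⟩ := rpowRate_lt_one hL ha0
  have hlog := logSqConst_pos a ha
  have h1CD : (0 : ℝ) ≤ 1 + CD := by linarith
  have h1CP : (0 : ℝ) ≤ 1 + CP := by linarith
  have h2C : (0 : ℝ) ≤ 2 * CDL * CΦ + CB := by positivity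
  have hC : 0 ≤ Λr * Γ * ((1 + CD) * (1 + CP) * (2 * CDL * CΦ + CB) * B * logSqConst a + B0 * CR) + ρ₂ :=
    add_nonneg (mul_nonneg (mul_nonneg hΛr hΓ) (add_nonneg
      (mul_nonneg (mul_nonneg (mul_nonneg (mul_nonneg h1CD h1CP) h2C) hB) hlog.le) (mul_nonneg hB0 hCR))) hρ₂
  exact ⟨h0, h1, actionRate_of_localRate hact hvol hC h0 hloc, hloc⟩

end Wall

/-! ## §7  Sanity examples -/
section Examples

/-- The defect kills cubics (symbol vanishing to fourth order at zero frequency)… -/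
example (j : ℤ) : defect₂ (fun i : ℤ => (i : ℚ) ^ 3) j = 0 := by
  simp only [defect₂, blockAvg₂, fineLap₂, coarseLap]
  push_cast
  ring

/-- … and sees quartics as the constant `−24` (`= k⁽⁴⁾(0)/L⁴·4!`-normalised fourth derivative): the defect is a
genuine second-order truncation error, not zero. -/
example (j : ℤ) : defect₂ (fun i : ℤ => (i : ℚ) ^ 4) j = -24 := by
  simp only [defect₂, blockAvg₂, fineLap₂, coarseLap]
  push_cast
  ring

/-- The flux of a quartic is affine (`6 − 24j`), and its coarse difference is the defect `−24`. -/
example (j : ℤ) : flux₂ (fun i : ℤ => (i : ℚ) ^ 4) j = 6 - 24 * j := by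
  simp only [flux₂, thirdDiff]
  push_cast
  ring

/-- A kink: `f(i) = |i|` (the one-dimensional caricature of the minimiser across a face, `Δ_f f = 8δ₀` in coarse
units).  The flux is supported on the SINGLE block containing the kink (value `−1` at `j = 0`, zero at `j = ±1, 2`),
so the defect is the dipole `δ₀ − δ₋₁`: no bulk term at all — the flux form localises the truncation error AT the
singular support of `Δ_f f`, which is the whole point. -/
example : flux₂ (fun i : ℤ => |(i : ℚ)|) 0 = -1 ∧ flux₂ (fun i : ℤ => |(i : ℚ)|) 1 = 0
    ∧ flux₂ (fun i : ℤ => |(i : ℚ)|) 2 = 0 ∧ flux₂ (fun i : ℤ => |(i : ℚ)|) (-1) = 0 := by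
  simp only [flux₂, thirdDiff]
  norm_num

example : defect₂ (fun i : ℤ => |(i : ℚ)|) 0 = 1 ∧ defect₂ (fun i : ℤ => |(i : ℚ)|) (-1) = -1
    ∧ defect₂ (fun i : ℤ => |(i : ℚ)|) 1 = 0 ∧ defect₂ (fun i : ℤ => |(i : ℚ)|) (-2) = 0 := by
  simp only [defect₂, blockAvg₂, fineLap₂, coarseLap]
  norm_num

/-- The squared-log constant at `a = 1/2` is `(e^{−3/4}/(1/4))² = 16·e^{−3/2}`. -/
example : logSqConst (1 / 2) = (Real.exp (-(3 / 4)) / (1 / 4)) ^ 2 := by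
  unfold logSqConst; norm_num

/-- Degenerate instance of the wall: everything zero satisfies `FluxSized` (the predicate is not vacuous-by-typo:
all five clauses are inhabited). -/
example : FluxSized (Set.univ : Set Unit) (fun _ _ => 0) (fun _ _ => 0) (fun _ _ => 0) (fun _ _ => 0)
    (fun _ _ => 0) 2 0 0 0 0 := by
  refine ⟨?_, ?_, ?_, ?_, ?_⟩ <;> intro k V _ <;> simp

end Examples

end Literature.MathematicalPhysics.QuantumFieldTheory.Balaban1983to89.T4DefectFluxForm
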